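import Literature.Geometry.Lorentzian.GaussianBeamErrors
import Literature.Geometry.Lorentzian.KerrSchildSlabDivergence
import HarnessLib

/-!
# The energy of the explicit real Gaussian beam: characterisation by the energy of the geodesic
(trunk G08 = T-LORENTZ, geometric optics; namespace `Literature.Geometry.Lorentzian.GaussianBeam`)

Sbierski, Anal. PDE 8 (2015), §4, the theorem and its proof (= arXiv:1311.2477v2 §2.3,
pp. 15–17), with the third remark after it (real-valued beams): the `N`-energy of a Gaussian beam
through the leaf `Σ_τ` is `E^N_τ(u_λ) = λ² ∫_{Σ_τ} |a|² Nφ₁·nφ₁ e^{-2λφ₂} + O(1)`, the current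
`X = λ²|a|² e^{-2λφ₂} grad φ₁` is approximately conserved (`∫ div X = O(1)` on `R_{[0,T]}`),
`Nφ₁ ≈ Nφ₁|_γ = −g(N, γ̇)` on a thin neighbourhood of `γ`, whence
`E^N_τ(ũ) → −g(N, γ̇)|_{γ_τ}` for the beam `ũ` normalised to initial energy `−g(N, γ̇)|_{γ(0)}`.

This file proves that statement for the real beam `Re(a e^{iλφ})` of `GaussianBeamFunction.lean`
in a time-foliated chart with coefficients `G = (g^{μν})`, the energy being the integral over
the coordinate leaf `{x⁰ = τ}` of the `T(dt,dt)`-density `KerrSchild.normalCurrent G · · 0`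
(for the Kerr–Schild chart: `T[u](V, V)`, `V = −g♯dt*`, the integrand of `Kerr.leafFlux … 0`),
and the energy of the geodesic being `κ(τ) = γ̇⁰` (`= −g(V, γ̇)`):

Contents (all for an admissible amplitude `A : BeamAmp D T` over beam data `D`):

* `BeamAmp.Bc`, `densH`, `densO`, `wdensH`, `wdensO` — the covector `B = ∂a + iλ a ∂φ` and the
  two densities of `GaussianBeamEnergyDensity.normalCurrent_re_beam`, `C^∞` with compact support;
  `BeamAmp.energy A λ τ = ∫ P⁰[Re(a e^{iλφ})](τ, y) dy` and **the decomposition**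
  `energy = ½ ∫ wdensH + ½ ∫ wdensO` (`energy_eq`), `wdensH = e^{-2λ Im φ} Re densC(B, B̄)`,
  `wdensO = Re(e^{2iλφ} densC(B, B))`;
* **the main term**: `Re densC(B,B̄) = λ² |a|² T² + (flat remainder)`, `T = (G Re dφ)⁰`
  (`exists_densH_remainder_bound`), whence `|∫ wdensH − λ² ∫ mdens| ≤ K (√λ)⁻¹`
  (`exists_wdensH_sub_main_bound`, Gaussian leaf integrals) and, on a leaf where
  `|T − κ(τ)| ≤ δ`, `|∫ mdens − κ(τ) ∫ fdens| ≤ δ ∫ fdens` (`abs_integral_mdens_sub_le`);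
* **approximate conservation**: the current `J^μ = λ² e^{-2λ Im φ} |a|² (G Re dφ)^μ` has
  divergence `λ² e^{-2λφ₂}(w₁ − 2λ ∑ Q^μ ∂_μφ₂)` (`sum_fderiv_Jcur`) with `w₁|_γ = 0` (the real
  transport law, `w₁_X`) and `∑ Q^μ∂_μφ₂ = ½|a|² Im(defect)` (`sum_Qc_mul_im`), whence by the
  divergence theorem on the slab `|λ² ∫ fdens(τ) − λ² ∫ fdens(0)| ≤ K_f` (`exists_flux_diff_bound`);
* **the initial lower bound** `λ² ∫ mdens(0, ·) ≥ g₀ √λ` (`exists_main_lower_bound`);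
* **the characterisation** (`energy_characterisation`): with the oscillatory cross terms bounded
  by `K_c` (proved for real beams in `GaussianBeamCross.lean`), `E(0) ≥ g₀√λ − K'` and
  `|E(τ) − (κ(τ)/κ(0)) E(0)| ≤ (2(1 + κ_max/κ(0))/κ(0)) δ E(0) + C_b` for `0 ≤ τ ≤ T`, `λ ≥ 1`.

## References

* J. Sbierski, *Characterisation of the energy of Gaussian beams on Lorentzian manifolds: with
  applications to black hole spacetimes*, Anal. PDE 8 (2015) 1379–1420, §4 (theorem, proof, third
  remark); arXiv:1311.2477v2 §2.3, Thm. 7, pp. 15–17 (key `Sbierski2015`).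
-/

noncomputable section

open Set Filter Complex MeasureTheory
open scoped ContDiff Topology ComplexConjugate

namespace Literature.Geometry.Lorentzian

namespace GaussianBeam

open KerrSchild

/-! ### Slices of compactly supported functions -/

/-- The slice `y ↦ F(τ, y)` of a compactly supported function on the chart has compact support.
[folklore] -/
theorem hasCompactSupport_slice {F' : Type*} [Zero F'] [TopologicalSpace F'] {F : E4 → F'}
    (hF : HasCompactSupport F) (τ : ℝ) : HasCompactSupport fun y : E3 ↦ F (E4.ofTimeSpace τ y) := by
  refine IsCompact.of_isClosed_subset (hF.image E4.spatial.continuous) (isClosed_tsupport _)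
    (closure_minimal (fun y hy ↦ ?_) (hF.image E4.spatial.continuous).isClosed)
  exact ⟨E4.ofTimeSpace τ y, subset_tsupport _ hy, E4.spatial_ofTimeSpace τ y⟩

/-- The slice of a continuous compactly supported function is integrable. [folklore] -/
theorem integrable_slice {F' : Type*} [NormedAddCommGroup F'] {F : E4 → F'} (hFc : Continuous F)
    (hF : HasCompactSupport F) (τ : ℝ) : Integrable fun y : E3 ↦ F (E4.ofTimeSpace τ y) :=
  (hFc.comp (E4.contDiff_ofTimeSpace τ (n := 0)).continuous).integrable_of_hasCompactSupport
    (hasCompactSupport_slice hF τ)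

namespace BeamAmp

variable {G : E4 → Fin 4 → Fin 4 → ℝ} {V : Set E4} {J : Set ℝ} {D : BeamData G V J} {T : ℝ}
  (A : BeamAmp D T)

/-! ### The covector `B = ∂a + iλ a ∂φ` and the two densities -/

/-- A function `C^∞` on `V ∩ {x⁰ ∈ J}` times a `C^∞` function supported in `supp a` is `C^∞`.
[folklore] -/
theorem contDiff_onU_mul {h f : E4 → ℂ} (hh : ContDiffOn ℝ ∞ h (V ∩ {x : E4 | x 0 ∈ J}))
    (hf : ContDiff ℝ ∞ f) (hfs : tsupport f ⊆ tsupport A.amp) : ContDiff ℝ ∞ fun x ↦ h x * f x :=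
  contDiff_mul_of_tsupport' D.isOpen_inter_slab hf (hfs.trans A.tsupp) hh

/-- The components `B_ν = ∂_νa + iλ a ∂_νφ` as functions on the chart.
[cite: Sbierski2015, arXiv (2.9)] -/
def Bc (lam : ℝ) (ν : Fin 4) (x : E4) : ℂ := dC A.amp x ν + I * lam * A.amp x * dC D.φ x ν

/-- `Bvec = B` componentwise. [folklore] -/
theorem beamB_eq_Bc (lam : ℝ) (x : E4) :
    beamB lam (dC A.amp x) (dC D.φ x) (A.amp x) = fun ν ↦ A.Bc lam ν x := by
  funext ν; rfl

/-- `B_ν` vanishes off `supp a`. [folklore] -/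
theorem Bc_eq_zero (lam : ℝ) (ν : Fin 4) {x : E4} (hx : x ∉ tsupport A.amp) : A.Bc lam ν x = 0 := by
  simp [Bc, A.dC_amp_eq_zero hx, image_eq_zero_of_notMem_tsupport hx]

/-- `supp B_ν ⊆ supp a`. [folklore] -/
theorem tsupport_Bc_subset (lam : ℝ) (ν : Fin 4) : tsupport (A.Bc lam ν) ⊆ tsupport A.amp :=
  closure_minimal (fun x hx ↦ by by_contra h; exact hx (A.Bc_eq_zero lam ν h)) (isClosed_tsupport _)

/-- `B_ν` is `C^∞`. [folklore] -/
theorem contDiff_Bc (lam : ℝ) (ν : Fin 4) : ContDiff ℝ ∞ (A.Bc lam ν) := by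
  have h2 : ContDiff ℝ ∞ fun x ↦ I * lam * A.amp x * dC D.φ x ν := by
    have hts : tsupport (fun x ↦ I * lam * A.amp x) ⊆ {x : E4 | x 0 ∈ J} :=
      (closure_minimal (fun x hx ↦ by
        by_contra h
        exact hx (by simp [image_eq_zero_of_notMem_tsupport h])) (isClosed_tsupport _)).trans
        A.tsupp_slab
    exact contDiff_mul_of_tsupport (isOpen_slab D.hJ) (contDiff_const.mul A.smooth) hts
      (D.contDiffOn_dC_φ ν)
  exact (A.contDiff_dC_amp ν).add h2

/-- `B̄_ν` is `C^∞`. [folklore] -/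
theorem contDiff_star_Bc (lam : ℝ) (ν : Fin 4) : ContDiff ℝ ∞ fun x ↦ star (A.Bc lam ν x) :=
  Complex.conjCLE.contDiff.comp (A.contDiff_Bc lam ν)

/-- `supp B̄_ν ⊆ supp a`. [folklore] -/
theorem tsupport_star_Bc_subset (lam : ℝ) (ν : Fin 4) :
    tsupport (fun x ↦ star (A.Bc lam ν x)) ⊆ tsupport A.amp :=
  closure_minimal (fun x hx ↦ by by_contra h; exact hx (by simp [A.Bc_eq_zero lam ν h]))
    (isClosed_tsupport _)

/-- **The non-oscillatory density** `densC(B, B̄)` (real up to the cast) as a function on the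
chart. [cite: Sbierski2015, §4 (proof of the theorem)] -/
def densH (lam : ℝ) (x : E4) : ℂ := densC G x (fun ν ↦ A.Bc lam ν x) (fun ν ↦ star (A.Bc lam ν x))

/-- **The oscillatory density** `densC(B, B)`. [cite: Sbierski2015, §4 (third remark after the theorem)] -/
def densO (lam : ℝ) (x : E4) : ℂ := densC G x (fun ν ↦ A.Bc lam ν x) (fun ν ↦ A.Bc lam ν x)

/-- `timeCo(B)` is `C^∞`. [folklore] -/
theorem contDiff_timeCo_Bc (lam : ℝ) : ContDiff ℝ ∞ fun x ↦ timeCo G x fun ν ↦ A.Bc lam ν x := by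
  unfold timeCo
  exact ContDiff.sum fun ν _ ↦ A.contDiff_onU_mul
    (Complex.ofRealCLM.contDiff.comp_contDiffOn ((D.hG 0 ν).mono inter_subset_left))
    (A.contDiff_Bc lam ν) (A.tsupport_Bc_subset lam ν)

/-- `timeCo(B̄)` is `C^∞`. [folklore] -/
theorem contDiff_timeCo_star_Bc (lam : ℝ) :
    ContDiff ℝ ∞ fun x ↦ timeCo G x (fun ν ↦ star (A.Bc lam ν x)) := by
  unfold timeCo
  exact ContDiff.sum fun ν _ ↦ A.contDiff_onU_mul
    (Complex.ofRealCLM.contDiff.comp_contDiffOn ((D.hG 0 ν).mono inter_subset_left))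
    (A.contDiff_star_Bc lam ν) (A.tsupport_star_Bc_subset lam ν)

/-- `s(B, w)` is `C^∞` for `w = B` or `B̄` componentwise smooth and supported in `supp a`. [folklore] -/
theorem contDiff_symbolC_Bc (lam : ℝ) {w : Fin 4 → E4 → ℂ} (hw : ∀ ν, ContDiff ℝ ∞ (w ν)) :
    ContDiff ℝ ∞ fun x ↦ symbolC G x (fun ν ↦ A.Bc lam ν x) fun ν ↦ w ν x := by
  unfold symbolC
  refine ContDiff.sum fun μ _ ↦ ContDiff.sum fun ν _ ↦ ?_
  have h1 : ContDiff ℝ ∞ fun x ↦ (G x μ ν : ℂ) * A.Bc lam μ x :=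
    A.contDiff_onU_mul (Complex.ofRealCLM.contDiff.comp_contDiffOn ((D.hG μ ν).mono inter_subset_left))
      (A.contDiff_Bc lam μ) (A.tsupport_Bc_subset lam μ)
  exact h1.mul (hw ν)

/-- `supp s(B, w) ⊆ supp a`. [folklore] -/
theorem tsupport_symbolC_Bc_subset (lam : ℝ) (w : Fin 4 → E4 → ℂ) :
    tsupport (fun x ↦ symbolC G x (fun ν ↦ A.Bc lam ν x) fun ν ↦ w ν x) ⊆ tsupport A.amp :=
  closure_minimal (fun x hx ↦ by
    by_contra h
    exact hx (by simp [symbolC, A.Bc_eq_zero lam _ h])) (isClosed_tsupport _)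

/-- **`densH` is `C^∞`.** [folklore] -/
theorem contDiff_densH (lam : ℝ) : ContDiff ℝ ∞ (A.densH lam) := by
  unfold densH densC
  refine ((A.contDiff_timeCo_Bc lam).mul (A.contDiff_timeCo_star_Bc lam)).sub ?_
  have hs := A.contDiff_symbolC_Bc lam (w := fun ν x ↦ star (A.Bc lam ν x)) (A.contDiff_star_Bc lam)
  have h : ContDiff ℝ ∞ fun x ↦ (G x 0 0 : ℂ) *
      symbolC G x (fun ν ↦ A.Bc lam ν x) (fun ν ↦ star (A.Bc lam ν x)) :=
    A.contDiff_onU_mul (Complex.ofRealCLM.contDiff.comp_contDiffOn ((D.hG 0 0).mono inter_subset_left))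
      hs (A.tsupport_symbolC_Bc_subset lam _)
  simpa [mul_assoc] using contDiff_const.mul h

/-- **`densO` is `C^∞`.** [folklore] -/
theorem contDiff_densO (lam : ℝ) : ContDiff ℝ ∞ (A.densO lam) := by
  unfold densO densC
  refine ((A.contDiff_timeCo_Bc lam).mul (A.contDiff_timeCo_Bc lam)).sub ?_
  have hs := A.contDiff_symbolC_Bc lam (w := fun ν x ↦ A.Bc lam ν x) (A.contDiff_Bc lam)
  have h : ContDiff ℝ ∞ fun x ↦ (G x 0 0 : ℂ) *
      symbolC G x (fun ν ↦ A.Bc lam ν x) (fun ν ↦ A.Bc lam ν x) :=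
    A.contDiff_onU_mul (Complex.ofRealCLM.contDiff.comp_contDiffOn ((D.hG 0 0).mono inter_subset_left))
      hs (A.tsupport_symbolC_Bc_subset lam _)
  simpa [mul_assoc] using contDiff_const.mul h

/-- `densH` vanishes off `supp a`. [folklore] -/
theorem densH_eq_zero (lam : ℝ) {x : E4} (hx : x ∉ tsupport A.amp) : A.densH lam x = 0 := by
  simp [densH, densC, timeCo, symbolC, A.Bc_eq_zero lam _ hx]

/-- `densO` vanishes off `supp a`. [folklore] -/
theorem densO_eq_zero (lam : ℝ) {x : E4} (hx : x ∉ tsupport A.amp) : A.densO lam x = 0 := by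
  simp [densO, densC, timeCo, symbolC, A.Bc_eq_zero lam _ hx]

/-- `supp densH ⊆ supp a`. [folklore] -/
theorem tsupport_densH_subset (lam : ℝ) : tsupport (A.densH lam) ⊆ tsupport A.amp :=
  closure_minimal (fun x hx ↦ by by_contra h; exact hx (A.densH_eq_zero lam h)) (isClosed_tsupport _)

/-- `supp densO ⊆ supp a`. [folklore] -/
theorem tsupport_densO_subset (lam : ℝ) : tsupport (A.densO lam) ⊆ tsupport A.amp :=
  closure_minimal (fun x hx ↦ by by_contra h; exact hx (A.densO_eq_zero lam h)) (isClosed_tsupport _)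

/-- **The weighted non-oscillatory density** `e^{-2λ Im φ} Re densH` as a `C^∞` function on the
chart (the weight is only smooth on the slab, where `supp a` lies). [cite: Sbierski2015, §4 (proof of the theorem)] -/
def wdensH (lam : ℝ) (x : E4) : ℝ := Real.exp (-2 * lam * (D.φ x).im) * (A.densH lam x).re

/-- **The oscillatory integrand** `Re(e^{2iλφ} densO)`. [cite: Sbierski2015, §4 (third remark)] -/
def wdensO (lam : ℝ) (x : E4) : ℝ := (cexp (2 * I * lam * D.φ x) * A.densO lam x).re

/-- `wdensH` is `C^∞`. [folklore] -/
theorem contDiff_wdensH (lam : ℝ) : ContDiff ℝ ∞ (A.wdensH lam) := by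
  have hre : ContDiff ℝ ∞ fun x ↦ (A.densH lam x).re := Complex.reCLM.contDiff.comp (A.contDiff_densH lam)
  have hts : tsupport (fun x ↦ (A.densH lam x).re) ⊆ {x : E4 | x 0 ∈ J} :=
    (closure_minimal (fun x hx ↦ by
      by_contra h
      exact hx (by simp [A.densH_eq_zero lam h])) (isClosed_tsupport _)).trans A.tsupp_slab
  have hw : ContDiffOn ℝ ∞ (fun x ↦ Real.exp (-2 * lam * (D.φ x).im)) {x : E4 | x 0 ∈ J} :=
    Real.contDiff_exp.comp_contDiffOn (contDiffOn_const.mul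
      (Complex.imCLM.contDiff.comp_contDiffOn D.contDiffOn_φ))
  exact contDiff_mul_of_tsupport' (isOpen_slab D.hJ) hre hts hw

/-- `e^{2iλφ} densO` is `C^∞`. [folklore] -/
theorem contDiff_cexp_mul_densO (lam : ℝ) :
    ContDiff ℝ ∞ fun x ↦ cexp (2 * I * lam * D.φ x) * A.densO lam x := by
  have hts : tsupport (A.densO lam) ⊆ {x : E4 | x 0 ∈ J} := (A.tsupport_densO_subset lam).trans A.tsupp_slab
  have hw : ContDiffOn ℝ ∞ (fun x ↦ cexp (2 * I * lam * D.φ x)) {x : E4 | x 0 ∈ J} :=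
    (contDiffOn_const.mul D.contDiffOn_φ).cexp
  exact contDiff_mul_of_tsupport' (isOpen_slab D.hJ) (A.contDiff_densO lam) hts hw

/-- `wdensO` is `C^∞`. [folklore] -/
theorem contDiff_wdensO (lam : ℝ) : ContDiff ℝ ∞ (A.wdensO lam) :=
  Complex.reCLM.contDiff.comp (A.contDiff_cexp_mul_densO lam)

/-- `wdensH` has compact support. [folklore] -/
theorem hasCompactSupport_wdensH (lam : ℝ) : HasCompactSupport (A.wdensH lam) :=
  IsCompact.of_isClosed_subset A.compact (isClosed_tsupport _)
    (closure_minimal (fun x hx ↦ by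
      by_contra h
      exact hx (by simp [wdensH, A.densH_eq_zero lam h])) (isClosed_tsupport _))

/-- `e^{2iλφ} densO` has compact support. [folklore] -/
theorem hasCompactSupport_cexp_mul_densO (lam : ℝ) :
    HasCompactSupport fun x ↦ cexp (2 * I * lam * D.φ x) * A.densO lam x :=
  IsCompact.of_isClosed_subset A.compact (isClosed_tsupport _)
    (closure_minimal (fun x hx ↦ by
      by_contra h
      exact hx (by simp [A.densO_eq_zero lam h])) (isClosed_tsupport _))

/-- `wdensO` has compact support. [folklore] -/
theorem hasCompactSupport_wdensO (lam : ℝ) : HasCompactSupport (A.wdensO lam) :=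
  IsCompact.of_isClosed_subset A.compact (isClosed_tsupport _)
    (closure_minimal (fun x hx ↦ by
      by_contra h
      exact hx (by simp [wdensO, A.densO_eq_zero lam h])) (isClosed_tsupport _))

/-! ### The energy and its decomposition -/

/-- **The energy of the real beam through the leaf `{x⁰ = τ}`**: `∫ P⁰[Re(a e^{iλφ})](τ, y) dy`.
[cite: Sbierski2015, §4 (the theorem)] -/
def energy (lam τ : ℝ) : ℝ := ∫ y, normalCurrent G (A.beam lam) (E4.ofTimeSpace τ y) 0

/-- **The density of the real beam, pointwise**:
`P⁰ = ½ wdensH + ½ wdensO`. [cite: Sbierski2015, §4 (proof of the theorem; third remark)] -/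
theorem normalCurrent_beam_eq (lam : ℝ) (x : E4) :
    normalCurrent G (A.beam lam) x 0 = 2⁻¹ * A.wdensH lam x + 2⁻¹ * A.wdensO lam x := by
  rw [A.normalCurrent_beam lam x, A.beamB_eq_Bc]
  have hst : (star fun ν ↦ A.Bc lam ν x) = fun ν ↦ star (A.Bc lam ν x) := rfl
  rw [hst]
  simp only [wdensH, wdensO, densH, densO]
  ring

/-- **Decomposition of the energy** into the non-oscillatory and the oscillatory parts:
`E(τ) = ½ ∫ wdensH(τ, ·) + ½ ∫ wdensO(τ, ·)`. [cite: Sbierski2015, §4 (proof of the theorem; third remark)] -/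
theorem energy_eq (lam τ : ℝ) :
    A.energy lam τ = 2⁻¹ * (∫ y, A.wdensH lam (E4.ofTimeSpace τ y)) +
      2⁻¹ * (∫ y, A.wdensO lam (E4.ofTimeSpace τ y)) := by
  unfold energy
  simp_rw [A.normalCurrent_beam_eq lam]
  have h1 := integrable_slice (A.contDiff_wdensH lam).continuous (A.hasCompactSupport_wdensH lam) τ
  have h2 := integrable_slice (A.contDiff_wdensO lam).continuous (A.hasCompactSupport_wdensO lam) τ
  rw [MeasureTheory.integral_add (h1.const_mul _) (h2.const_mul _), MeasureTheory.integral_const_mul,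
    MeasureTheory.integral_const_mul]

/-- The oscillatory part as the real part of a complex leaf integral:
`∫ wdensO(τ, ·) = Re ∫ e^{2iλφ} densO`. [folklore] -/
theorem integral_wdensO_eq (lam τ : ℝ) :
    ∫ y, A.wdensO lam (E4.ofTimeSpace τ y) =
      (∫ y, cexp (2 * I * lam * D.φ (E4.ofTimeSpace τ y)) * A.densO lam (E4.ofTimeSpace τ y)).re := by
  unfold wdensO
  exact integral_re (integrable_slice (A.contDiff_cexp_mul_densO lam).continuous
    (A.hasCompactSupport_cexp_mul_densO lam) τ)

end BeamAmp

/-! ### Uniform bounds on the support, and the flat bound for `a · Im ∂φ` -/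

namespace BeamAmp

variable {G : E4 → Fin 4 → Fin 4 → ℝ} {V : Set E4} {J : Set ℝ} {D : BeamData G V J} {T : ℝ}
  (A : BeamAmp D T)

/-- A function continuous on an open set containing the compact `supp a` is bounded there. [folklore] -/
theorem exists_bound_on_tsupport {F' : Type*} [NormedAddCommGroup F'] {f : E4 → F'} {U : Set E4}
    (hU : tsupport A.amp ⊆ U) (hf : ContinuousOn f U) :
    ∃ C : ℝ, 0 ≤ C ∧ ∀ x ∈ tsupport A.amp, ‖f x‖ ≤ C := by
  obtain ⟨C, hC⟩ := (A.compact.image_of_continuousOn (hf.mono hU)).isBounded.exists_norm_le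
  exact ⟨max C 0, le_max_right _ _, fun x hx ↦ (hC _ ⟨x, hx, rfl⟩).trans (le_max_left _ _)⟩

/-- `|G^{μν}| ≤ C_G` on `supp a`. [folklore] -/
theorem exists_coeff_bound : ∃ C : ℝ, 0 ≤ C ∧ ∀ x ∈ tsupport A.amp, ∀ μ ν, |G x μ ν| ≤ C := by
  have h : ∀ μ ν, ∃ C : ℝ, 0 ≤ C ∧ ∀ x ∈ tsupport A.amp, ‖G x μ ν‖ ≤ C := fun μ ν ↦
    A.exists_bound_on_tsupport A.tsupp_V (D.hG μ ν).continuousOn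
  choose C hC0 hC using h
  refine ⟨∑ μ, ∑ ν, C μ ν, Finset.sum_nonneg fun μ _ ↦ Finset.sum_nonneg fun ν _ ↦ hC0 μ ν,
    fun x hx μ ν ↦ ?_⟩
  calc |G x μ ν| = ‖G x μ ν‖ := (Real.norm_eq_abs _).symm
    _ ≤ C μ ν := hC μ ν x hx
    _ ≤ ∑ ν', C μ ν' := Finset.single_le_sum (f := fun ν' ↦ C μ ν') (fun ν' _ ↦ hC0 μ ν') (Finset.mem_univ ν)
    _ ≤ ∑ μ', ∑ ν', C μ' ν' := Finset.single_le_sum (f := fun μ' ↦ ∑ ν', C μ' ν')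
        (fun μ' _ ↦ Finset.sum_nonneg fun ν' _ ↦ hC0 μ' ν') (Finset.mem_univ μ)

/-- `‖a‖ ≤ C_a`. [folklore] -/
theorem exists_amp_bound : ∃ C : ℝ, 0 ≤ C ∧ ∀ x, ‖A.amp x‖ ≤ C := by
  obtain ⟨C, hC⟩ := A.smooth.continuous.bounded_above_of_compact_support A.compact
  exact ⟨max C 0, le_max_right _ _, fun x ↦ (hC x).trans (le_max_left _ _)⟩

/-- `‖∂_νa‖ ≤ C'_a`. [folklore] -/
theorem exists_dC_amp_bound : ∃ C : ℝ, 0 ≤ C ∧ ∀ x ν, ‖dC A.amp x ν‖ ≤ C := by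
  have h : ∀ ν, ∃ C : ℝ, ∀ x, ‖dC A.amp x ν‖ ≤ C := fun ν ↦
    (A.contDiff_dC_amp ν).continuous.bounded_above_of_compact_support
      (IsCompact.of_isClosed_subset A.compact (isClosed_tsupport _) (A.tsupport_dC_amp_subset ν))
  choose C hC using h
  refine ⟨∑ ν, max (C ν) 0, Finset.sum_nonneg fun ν _ ↦ le_max_right _ _, fun x ν ↦ ?_⟩
  exact ((hC ν x).trans (le_max_left _ _)).trans
    (Finset.single_le_sum (f := fun ν ↦ max (C ν) 0) (fun ν _ ↦ le_max_right _ _) (Finset.mem_univ ν))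

/-- `‖∂_νφ‖ ≤ C_φ` on `supp a`. [folklore] -/
theorem exists_dC_φ_bound : ∃ C : ℝ, 0 ≤ C ∧ ∀ x ∈ tsupport A.amp, ∀ ν, ‖dC D.φ x ν‖ ≤ C := by
  have h : ∀ ν, ∃ C : ℝ, 0 ≤ C ∧ ∀ x ∈ tsupport A.amp, ‖dC D.φ x ν‖ ≤ C := fun ν ↦
    A.exists_bound_on_tsupport A.tsupp_slab (D.contDiffOn_dC_φ ν).continuousOn
  choose C hC0 hC using h
  refine ⟨∑ ν, C ν, Finset.sum_nonneg fun ν _ ↦ hC0 ν, fun x hx ν ↦ ?_⟩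
  exact (hC ν x hx).trans (Finset.single_le_sum (f := C) (fun ν _ ↦ hC0 ν) (Finset.mem_univ ν))

/-- **`a · Im ∂_νφ` read on `ℝ × E3`** (vanishes on the curve: `Im ∂φ|_X = Im P = 0`). [folklore] -/
def aIm (ν : Fin 4) (q : ℝ × E3) : ℂ :=
  A.amp (E4.ofTimeSpace q.1 q.2) * ((dC D.φ (E4.ofTimeSpace q.1 q.2) ν).im : ℂ)

/-- `a · Im ∂_νφ` is `C^∞`. [folklore] -/
theorem contDiff_aIm (ν : Fin 4) : ContDiff ℝ ∞ (A.aIm ν) := by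
  have h : ContDiff ℝ ∞ fun x ↦ A.amp x * ((dC D.φ x ν).im : ℂ) :=
    contDiff_mul_of_tsupport (isOpen_slab D.hJ) A.smooth A.tsupp_slab
      (Complex.ofRealCLM.contDiff.comp_contDiffOn
        (Complex.imCLM.contDiff.comp_contDiffOn (D.contDiffOn_dC_φ ν)))
  exact h.comp contDiff_ofTimeSpace_uncurry

/-- `a · Im ∂_νφ` has compact support. [folklore] -/
theorem hasCompactSupport_aIm (ν : Fin 4) : HasCompactSupport (A.aIm ν) :=
  hasCompactSupport_comp_ofTimeSpace (f := fun x ↦ A.amp x * ((dC D.φ x ν).im : ℂ)) A.compact.mul_right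

/-- `a · Im ∂_νφ` vanishes along the centre. [cite: Sbierski2015, §3 (3.12)] -/
theorem iteratedFDeriv_aIm_eq_zero (ν : Fin 4) (t : ℝ) {k : ℕ} (hk : k ≤ 0) :
    iteratedFDeriv ℝ k (fun y ↦ A.aIm ν (t, y)) (A.ce t) = 0 := by
  obtain rfl : k = 0 := Nat.le_zero.1 hk
  ext m
  rw [iteratedFDeriv_zero_apply, zero_apply]
  by_cases ht : t ∈ A.timeHull
  · have htJ := A.timeHull_subset ht
    rw [A.ce_eq ht]
    have hre : dC D.φ (E4.ofTimeSpace t (D.c t)) ν = (D.P t ν : ℂ) := by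
      rw [BeamData.φ, dC_phase D.P D.M D.c D.hJ D.hP D.hM D.hc (by simpa using htJ) ν,
        dphase_curve D.P D.M D.c t (D.hPX t htJ)]
    simp [aIm, hre]
  · simp [aIm, A.amp_ofTimeSpace_eq_zero ht]

/-- **Flat bound for `a · Im ∂φ`**: `‖a(x)‖ |Im ∂_νφ(x)| ≤ D ‖x⃗ − c(x⁰)‖` over the hull.
[cite: Sbierski2015, §4 (proof of the theorem: "`dφ₂|_γ = 0`, so these terms are of lower order")] -/
theorem exists_aIm_bound : ∃ Dφ : ℝ, 0 ≤ Dφ ∧ ∀ t ∈ A.timeHull, ∀ y : E3, ∀ ν,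
    ‖A.amp (E4.ofTimeSpace t y)‖ * |(dC D.φ (E4.ofTimeSpace t y) ν).im| ≤ Dφ * ‖y - D.c t‖ := by
  have h : ∀ ν, ∃ Dν : ℝ, 0 ≤ Dν ∧ ∀ t y, ‖A.aIm ν (t, y)‖ ≤ Dν * ‖y - A.ce t‖ ^ (0 + 1) := fun ν ↦
    Literature.Analysis.Asymptotics.GaussianBeam.exists_norm_le_norm_sub_pow A.ce A.contDiff_ce
      (A.aIm ν) (A.contDiff_aIm ν) (A.hasCompactSupport_aIm ν) 0
      fun t k hk ↦ A.iteratedFDeriv_aIm_eq_zero ν t hk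
  choose Dν hD0 hD using h
  refine ⟨∑ ν, Dν ν, Finset.sum_nonneg fun ν _ ↦ hD0 ν, fun t ht y ν ↦ ?_⟩
  have h1 := hD ν t y
  rw [A.ce_eq ht, zero_add, pow_one] at h1
  have h2 : ‖A.aIm ν (t, y)‖ = ‖A.amp (E4.ofTimeSpace t y)‖ * |(dC D.φ (E4.ofTimeSpace t y) ν).im| := by
    rw [aIm, norm_mul, Complex.norm_real, Real.norm_eq_abs]
  rw [h2] at h1
  exact h1.trans (mul_le_mul_of_nonneg_right
    (Finset.single_le_sum (f := Dν) (fun ν _ ↦ hD0 ν) (Finset.mem_univ ν)) (norm_nonneg _))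

end BeamAmp

/-! ### Norm bounds for the density form -/

section FormBounds

variable (G : E4 → Fin 4 → Fin 4 → ℝ) (x : E4) {C : ℝ} (hC : ∀ μ ν, |G x μ ν| ≤ C)
include hC

/-- `‖timeCo z‖ ≤ C ∑ ‖z_ν‖`. [folklore] -/
theorem norm_timeCo_le (z : Fin 4 → ℂ) : ‖timeCo G x z‖ ≤ C * ∑ ν, ‖z ν‖ := by
  unfold timeCo
  refine (norm_sum_le _ _).trans ?_
  rw [Finset.mul_sum]
  refine Finset.sum_le_sum fun ν _ ↦ ?_
  rw [norm_mul, Complex.norm_real, Real.norm_eq_abs]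
  exact mul_le_mul_of_nonneg_right (hC 0 ν) (norm_nonneg _)

/-- `‖s(z, w)‖ ≤ C (∑ ‖z_μ‖)(∑ ‖w_ν‖)`. [folklore] -/
theorem norm_symbolC_le (z w : Fin 4 → ℂ) :
    ‖symbolC G x z w‖ ≤ C * ((∑ μ, ‖z μ‖) * ∑ ν, ‖w ν‖) := by
  unfold symbolC
  refine (norm_sum_le _ _).trans ?_
  rw [Finset.sum_mul, Finset.mul_sum]
  refine Finset.sum_le_sum fun μ _ ↦ (norm_sum_le _ _).trans ?_
  rw [Finset.mul_sum, Finset.mul_sum]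
  refine Finset.sum_le_sum fun ν _ ↦ ?_
  rw [norm_mul, norm_mul, Complex.norm_real, Real.norm_eq_abs]
  have := hC μ ν
  have hz := norm_nonneg (z μ)
  have hw := norm_nonneg (w ν)
  calc |G x μ ν| * ‖z μ‖ * ‖w ν‖ ≤ C * ‖z μ‖ * ‖w ν‖ := by gcongr
    _ = C * (‖z μ‖ * ‖w ν‖) := by ring

/-- The coefficient bound is non-negative. [folklore] -/
theorem coeffBound_nonneg : 0 ≤ C := (abs_nonneg _).trans (hC 0 0)

/-- **`‖densC(z, w)‖ ≤ (3/2) C² (∑ ‖z_μ‖)(∑ ‖w_ν‖)`.** [folklore] -/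
theorem norm_densC_le (z w : Fin 4 → ℂ) :
    ‖densC G x z w‖ ≤ 3 / 2 * C ^ 2 * ((∑ μ, ‖z μ‖) * ∑ ν, ‖w ν‖) := by
  have hC0 := coeffBound_nonneg G x hC
  have hz : 0 ≤ ∑ μ, ‖z μ‖ := Finset.sum_nonneg fun _ _ ↦ norm_nonneg _
  have hw : 0 ≤ ∑ ν, ‖w ν‖ := Finset.sum_nonneg fun _ _ ↦ norm_nonneg _
  unfold densC
  refine (norm_sub_le _ _).trans ?_
  have h1 : ‖timeCo G x z * timeCo G x w‖ ≤ C ^ 2 * ((∑ μ, ‖z μ‖) * ∑ ν, ‖w ν‖) := by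
    rw [norm_mul]
    calc ‖timeCo G x z‖ * ‖timeCo G x w‖ ≤ (C * ∑ μ, ‖z μ‖) * (C * ∑ ν, ‖w ν‖) :=
          mul_le_mul (norm_timeCo_le G x hC z) (norm_timeCo_le G x hC w) (norm_nonneg _) (by positivity)
      _ = C ^ 2 * ((∑ μ, ‖z μ‖) * ∑ ν, ‖w ν‖) := by ring
  have h2 : ‖2⁻¹ * (G x 0 0 : ℂ) * symbolC G x z w‖ ≤ 2⁻¹ * C ^ 2 * ((∑ μ, ‖z μ‖) * ∑ ν, ‖w ν‖) := by
    rw [norm_mul, norm_mul, Complex.norm_real, Real.norm_eq_abs]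
    have hn : ‖(2⁻¹ : ℂ)‖ = 2⁻¹ := by simp
    rw [hn]
    calc 2⁻¹ * |G x 0 0| * ‖symbolC G x z w‖ ≤ 2⁻¹ * C * (C * ((∑ μ, ‖z μ‖) * ∑ ν, ‖w ν‖)) :=
          mul_le_mul (mul_le_mul_of_nonneg_left (hC 0 0) (by norm_num)) (norm_symbolC_le G x hC z w)
            (norm_nonneg _) (by positivity)
      _ = 2⁻¹ * C ^ 2 * ((∑ μ, ‖z μ‖) * ∑ ν, ‖w ν‖) := by ring
  linarith

/-- The real symbol on a real vector: `|∑ G_{αβ} v_α v_β| ≤ C (∑ |v_ν|)²`. [folklore] -/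
theorem abs_symReal_le (v : Fin 4 → ℝ) : |∑ α, ∑ β, G x α β * v α * v β| ≤ C * (∑ ν, |v ν|) ^ 2 := by
  have hexp : C * (∑ ν, |v ν|) ^ 2 = ∑ α, ∑ β, C * (|v α| * |v β|) := by
    rw [sq, Finset.sum_mul_sum, Finset.mul_sum]
    exact Finset.sum_congr rfl fun α _ ↦ by rw [Finset.mul_sum]
  rw [hexp]
  refine (Finset.abs_sum_le_sum_abs _ _).trans (Finset.sum_le_sum fun α _ ↦
    (Finset.abs_sum_le_sum_abs _ _).trans (Finset.sum_le_sum fun β _ ↦ ?_))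
  rw [abs_mul, abs_mul]
  have := hC α β
  have ha := abs_nonneg (v α)
  have hb := abs_nonneg (v β)
  calc |G x α β| * |v α| * |v β| ≤ C * |v α| * |v β| := by gcongr
    _ = C * (|v α| * |v β|) := by ring

/-- The real `P⁰`-form on a real vector: `|P(v)| ≤ (3/2) C² (∑ |v_ν|)²`. [folklore] -/
theorem abs_pform_le (v : Fin 4 → ℝ) :
    |(∑ ν, G x 0 ν * v ν) * (∑ ν, G x 0 ν * v ν) - 2⁻¹ * G x 0 0 * ∑ α, ∑ β, G x α β * v α * v β| ≤
      3 / 2 * C ^ 2 * (∑ ν, |v ν|) ^ 2 := by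
  have hC0 := coeffBound_nonneg G x hC
  have hs : 0 ≤ ∑ ν, |v ν| := Finset.sum_nonneg fun _ _ ↦ abs_nonneg _
  have hT : |∑ ν, G x 0 ν * v ν| ≤ C * ∑ ν, |v ν| := by
    refine (Finset.abs_sum_le_sum_abs _ _).trans ?_
    rw [Finset.mul_sum]
    refine Finset.sum_le_sum fun ν _ ↦ ?_
    rw [abs_mul]
    exact mul_le_mul_of_nonneg_right (hC 0 ν) (abs_nonneg _)
  have hS : |∑ α, ∑ β, G x α β * v α * v β| ≤ C * (∑ ν, |v ν|) ^ 2 := abs_symReal_le G x hC v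
  refine (abs_sub _ _).trans ?_
  rw [abs_mul, abs_mul, abs_mul]
  have h1 : |∑ ν, G x 0 ν * v ν| * |∑ ν, G x 0 ν * v ν| ≤ (C * ∑ ν, |v ν|) * (C * ∑ ν, |v ν|) :=
    mul_le_mul hT hT (abs_nonneg _) (by positivity)
  have h2 : |(2⁻¹ : ℝ)| * |G x 0 0| * |∑ α, ∑ β, G x α β * v α * v β| ≤ 2⁻¹ * C * (C * (∑ ν, |v ν|) ^ 2) := by
    rw [abs_of_pos (by norm_num : (0 : ℝ) < 2⁻¹)]
    exact mul_le_mul (mul_le_mul_of_nonneg_left (hC 0 0) (by norm_num)) hS (abs_nonneg _) (by positivity)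
  nlinarith

end FormBounds

/-! ### The non-oscillatory density: main term plus a flat remainder -/

namespace BeamAmp

variable {G : E4 → Fin 4 → Fin 4 → ℝ} {V : Set E4} {J : Set ℝ} {D : BeamData G V J} {T : ℝ}
  (A : BeamAmp D T)

/-- `T(x) = ∑_ν G^{0ν}(x) Re ∂_νφ(x)` — the time component of `grad φ₁`, i.e. `−Vφ₁`; on the
curve it equals `κ`. [cite: Sbierski2015, §4 (proof of the theorem: `Nφ₁`, `nφ₁`)] -/
def _root_.Literature.Geometry.Lorentzian.GaussianBeam.BeamData.tCo (D : BeamData G V J) (x : E4) : ℝ :=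
  ∑ ν, G x 0 ν * (dC D.φ x ν).re

/-- On the curve `T(X(t)) = κ(t)`. [cite: Sbierski2015, §4 (proof of the theorem)] -/
theorem _root_.Literature.Geometry.Lorentzian.GaussianBeam.BeamData.tCo_X (D : BeamData G V J)
    {t : ℝ} (ht : t ∈ J) : D.tCo (D.X t) = D.κ t := by
  unfold BeamData.tCo
  have hx0 : (D.X t) 0 ∈ J := by simpa [BeamData.X] using ht
  have hre : ∀ ν, (dC D.φ (D.X t) ν).re = D.P t ν := fun ν ↦ by
    rw [BeamData.φ, dC_phase D.P D.M D.c D.hJ D.hP D.hM D.hc hx0 ν, BeamData.X,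
      dphase_curve D.P D.M D.c t (D.hPX t ht), Complex.ofReal_re]
  simp only [hre]
  have h := D.hvel t ht 0
  simpa [xdot, BeamData.X] using h

/-- The real symbol of the real parts minus that of the imaginary parts is the real part of the
complex symbol: `Re s(ζ, ζ) = s(Re ζ, Re ζ) − s(Im ζ, Im ζ)`. [folklore] -/
theorem re_symbolC_self (x : E4) (ζ : Fin 4 → ℂ) :
    (symbolC G x ζ ζ).re = (∑ α, ∑ β, G x α β * (ζ α).re * (ζ β).re) -
      ∑ α, ∑ β, G x α β * (ζ α).im * (ζ β).im := by
  simp only [symbolC, Complex.re_sum, Complex.mul_re, Complex.mul_im, Complex.ofReal_re,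
    Complex.ofReal_im, zero_mul, sub_zero, ← Finset.sum_sub_distrib]
  exact Finset.sum_congr rfl fun α _ ↦ Finset.sum_congr rfl fun β _ ↦ by ring

/-- **The non-oscillatory density is the main term `λ² |a|² T²` plus a flat remainder**: there are
`K₀, K₁, K₂, K₃ ≥ 0` such that for `λ ≥ 0`, `x⁰` in the hull and all `x⃗`,
`|Re densH(x) − λ² |a(x)|² T(x)²| ≤ λ² (K₂ ‖x⃗ − c(x⁰)‖² + K₃ ‖x⃗ − c(x⁰)‖³) + λ K₁ + K₀`
(the terms `Nφ₂·nφ₂`, `dφ₁·dφ₁`, `O(λ)`, `O(1)` of Sbierski's display, which are "of lower order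
after integration over `Σ_τ`"). [cite: Sbierski2015, §4 (proof of the theorem)] -/
theorem exists_densH_remainder_bound : ∃ K₀ K₁ K₂ K₃ : ℝ, 0 ≤ K₀ ∧ 0 ≤ K₁ ∧ 0 ≤ K₂ ∧ 0 ≤ K₃ ∧
    ∀ lam : ℝ, 0 ≤ lam → ∀ t ∈ A.timeHull, ∀ y : E3,
      |(A.densH lam (E4.ofTimeSpace t y)).re -
          lam ^ 2 * ‖A.amp (E4.ofTimeSpace t y)‖ ^ 2 * D.tCo (E4.ofTimeSpace t y) ^ 2| ≤
        lam ^ 2 * (K₂ * ‖y - D.c t‖ ^ 2 + K₃ * ‖y - D.c t‖ ^ 3) + lam * K₁ + K₀ := by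
  obtain ⟨C, hC0, hC⟩ := A.exists_coeff_bound
  obtain ⟨Ca, hCa0, hCa⟩ := A.exists_amp_bound
  obtain ⟨Ca', hCa'0, hCa'⟩ := A.exists_dC_amp_bound
  obtain ⟨Cφ, hCφ0, hCφ⟩ := A.exists_dC_φ_bound
  obtain ⟨Dφ, hDφ0, hDφ⟩ := A.exists_aIm_bound
  obtain ⟨D₁, hD₁0, hD₁⟩ := A.exists_eik_bound
  refine ⟨3 / 2 * C ^ 2 * ((4 * Ca') * (4 * Ca')), 2 * Ca * (3 / 2 * C ^ 2 * ((4 * Cφ) * (4 * Ca'))),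
    2 * C ^ 2 * (4 * Dφ) ^ 2, 2⁻¹ * C * (Ca * D₁), by positivity, by positivity, by positivity,
    by positivity, fun lam hlam t ht y ↦ ?_⟩
  set x := E4.ofTimeSpace t y with hx
  by_cases hxs : x ∈ tsupport A.amp
  · -- abbreviations
    set a0 : ℂ := A.amp x with ha0
    set a' : Fin 4 → ℂ := dC A.amp x with ha'
    set φ' : Fin 4 → ℂ := dC D.φ x with hφ'
    have hxJ : x 0 ∈ J := A.tsupp_slab hxs
    have hGs : ∀ μ ν, G x μ ν = G x ν μ := D.hGsymm x
    -- the expansion of `densH`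
    have hB : (fun ν ↦ A.Bc lam ν x) = beamB lam a' φ' a0 := (A.beamB_eq_Bc lam x).symm
    have hexp : A.densH lam x = (lam : ℂ) ^ 2 * (a0 * conj a0) * densC G x φ' (star φ') +
        (I * lam * a0 * densC G x φ' (star a') - I * lam * conj a0 * densC G x a' (star φ')) +
        densC G x a' (star a') := by
      rw [densH, hB]
      exact densC_beamB_star G x lam a' φ' a0
    have hsplit : densC G x φ' (star φ') =
        ((densC G x (fun ν ↦ ((φ' ν).re : ℂ)) (fun ν ↦ ((φ' ν).re : ℂ))).re : ℂ) +
          ((densC G x (fun ν ↦ ((φ' ν).im : ℂ)) (fun ν ↦ ((φ' ν).im : ℂ))).re : ℂ) :=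
      densC_star_eq G x hGs φ'
    -- the real `P⁰`-forms
    set Pre : ℝ := (∑ ν, G x 0 ν * (φ' ν).re) * (∑ ν, G x 0 ν * (φ' ν).re) -
      2⁻¹ * G x 0 0 * ∑ α, ∑ β, G x α β * (φ' α).re * (φ' β).re with hPre
    set Pim : ℝ := (∑ ν, G x 0 ν * (φ' ν).im) * (∑ ν, G x 0 ν * (φ' ν).im) -
      2⁻¹ * G x 0 0 * ∑ α, ∑ β, G x α β * (φ' α).im * (φ' β).im with hPim
    have hPre' : (densC G x (fun ν ↦ ((φ' ν).re : ℂ)) (fun ν ↦ ((φ' ν).re : ℂ))).re = Pre := by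
      rw [densC_ofReal, Complex.ofReal_re]
    have hPim' : (densC G x (fun ν ↦ ((φ' ν).im : ℂ)) (fun ν ↦ ((φ' ν).im : ℂ))).re = Pim := by
      rw [densC_ofReal, Complex.ofReal_re]
    have haa : a0 * conj a0 = ((‖a0‖ ^ 2 : ℝ) : ℂ) := by
      rw [Complex.mul_conj, Complex.normSq_eq_norm_sq]
    -- the remainder as a complex number
    set symRe : ℝ := ∑ α, ∑ β, G x α β * (φ' α).re * (φ' β).re with hsymRe
    set symIm : ℝ := ∑ α, ∑ β, G x α β * (φ' α).im * (φ' β).im with hsymIm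
    set mid : ℂ := I * lam * a0 * densC G x φ' (star a') - I * lam * conj a0 * densC G x a' (star φ')
      with hmid
    set last : ℂ := densC G x a' (star a') with hlast
    have htCo : D.tCo x = ∑ ν, G x 0 ν * (φ' ν).re := rfl
    have hre : (A.densH lam x).re - lam ^ 2 * ‖a0‖ ^ 2 * D.tCo x ^ 2 =
        lam ^ 2 * ‖a0‖ ^ 2 * (-(2⁻¹ * G x 0 0 * symRe) + Pim) + mid.re + last.re := by
      rw [hexp, hsplit, hPre', hPim', haa, htCo]
      have h2 : ((lam : ℂ) ^ 2 * (((‖a0‖ ^ 2 : ℝ) : ℂ)) * ((Pre : ℂ) + (Pim : ℂ))).re =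
          lam ^ 2 * ‖a0‖ ^ 2 * (Pre + Pim) := by
        have : ((lam : ℂ) ^ 2 * (((‖a0‖ ^ 2 : ℝ) : ℂ)) * ((Pre : ℂ) + (Pim : ℂ))) =
            ((lam ^ 2 * ‖a0‖ ^ 2 * (Pre + Pim) : ℝ) : ℂ) := by push_cast; ring
        rw [this, Complex.ofReal_re]
      simp only [Complex.add_re, h2]
      rw [hPre]
      ring
    rw [hre]
    -- sizes of the ingredients
    have hd : ∀ ν, ‖a0‖ * |(φ' ν).im| ≤ Dφ * ‖y - D.c t‖ := fun ν ↦ hDφ t ht y ν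
    have hsumv : ∑ ν, |‖a0‖ * (φ' ν).im| ≤ 4 * (Dφ * ‖y - D.c t‖) := by
      have : ∀ ν, |‖a0‖ * (φ' ν).im| ≤ Dφ * ‖y - D.c t‖ := fun ν ↦ by
        rw [abs_mul, abs_of_nonneg (norm_nonneg _)]; exact hd ν
      calc ∑ ν, |‖a0‖ * (φ' ν).im| ≤ ∑ _ν : Fin 4, Dφ * ‖y - D.c t‖ := Finset.sum_le_sum fun ν _ ↦ this ν
        _ = 4 * (Dφ * ‖y - D.c t‖) := by simp
    have hsumφ : ∑ ν, ‖φ' ν‖ ≤ 4 * Cφ := by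
      calc ∑ ν, ‖φ' ν‖ ≤ ∑ _ν : Fin 4, Cφ := Finset.sum_le_sum fun ν _ ↦ hCφ x hxs ν
        _ = 4 * Cφ := by simp
    have hsuma : ∑ ν, ‖a' ν‖ ≤ 4 * Ca' := by
      calc ∑ ν, ‖a' ν‖ ≤ ∑ _ν : Fin 4, Ca' := Finset.sum_le_sum fun ν _ ↦ hCa' x ν
        _ = 4 * Ca' := by simp
    have hsumφs : ∑ ν, ‖(star φ') ν‖ ≤ 4 * Cφ := by
      simpa [Pi.star_apply, Complex.star_def, Complex.norm_conj] using hsumφ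
    have hsumas : ∑ ν, ‖(star a') ν‖ ≤ 4 * Ca' := by
      simpa [Pi.star_apply, Complex.star_def, Complex.norm_conj] using hsuma
    have ha0 : ‖a0‖ ≤ Ca := hCa x
    have hdn : 0 ≤ ‖y - D.c t‖ := norm_nonneg _
    -- (i) the real symbol: `‖a‖² |symRe| ≤ Ca D₁ d³ + 16 C Dφ² d²`
    have hsymsplit : symRe = (symbolC G x φ' φ').re + symIm := by
      rw [re_symbolC_self]; ring
    have heik : ‖a0 * symbolC G x φ' φ'‖ ≤ D₁ * ‖y - D.c t‖ ^ 3 := by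
      have hs : symbolC G x φ' φ' = defect G D.P D.M D.c x := by
        rw [hφ', BeamData.φ]
        exact symbolC_phase G D.P D.M D.c D.hJ D.hP D.hM D.hc hxJ
      rw [hs]
      exact hD₁ t ht y
    have hi1 : ‖a0‖ ^ 2 * |(symbolC G x φ' φ').re| ≤ Ca * (D₁ * ‖y - D.c t‖ ^ 3) := by
      calc ‖a0‖ ^ 2 * |(symbolC G x φ' φ').re| ≤ ‖a0‖ ^ 2 * ‖symbolC G x φ' φ'‖ :=
            mul_le_mul_of_nonneg_left (Complex.abs_re_le_norm _) (by positivity)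
        _ = ‖a0‖ * ‖a0 * symbolC G x φ' φ'‖ := by rw [norm_mul]; ring
        _ ≤ Ca * (D₁ * ‖y - D.c t‖ ^ 3) := mul_le_mul ha0 heik (norm_nonneg _) hCa0
    have hi2 : ‖a0‖ ^ 2 * |symIm| ≤ C * (4 * (Dφ * ‖y - D.c t‖)) ^ 2 := by
      have hv : ‖a0‖ ^ 2 * symIm = ∑ α, ∑ β, G x α β * (‖a0‖ * (φ' α).im) * (‖a0‖ * (φ' β).im) := by
        rw [hsymIm, Finset.mul_sum]
        refine Finset.sum_congr rfl fun α _ ↦ ?_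
        rw [Finset.mul_sum]
        exact Finset.sum_congr rfl fun β _ ↦ by ring
      have hb := abs_symReal_le G x (hC x hxs) fun ν ↦ ‖a0‖ * (φ' ν).im
      rw [← hv, abs_mul, abs_of_nonneg (by positivity : (0 : ℝ) ≤ ‖a0‖ ^ 2)] at hb
      exact hb.trans (mul_le_mul_of_nonneg_left (pow_le_pow_left₀ (Finset.sum_nonneg fun _ _ ↦ abs_nonneg _) hsumv 2) hC0)
    -- (ii) `‖a‖² |Pim| ≤ (3/2) C² (4 Dφ d)²`
    have hii : ‖a0‖ ^ 2 * |Pim| ≤ 3 / 2 * C ^ 2 * (4 * (Dφ * ‖y - D.c t‖)) ^ 2 := by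
      have hv : ‖a0‖ ^ 2 * Pim =
          (∑ ν, G x 0 ν * (‖a0‖ * (φ' ν).im)) * (∑ ν, G x 0 ν * (‖a0‖ * (φ' ν).im)) -
            2⁻¹ * G x 0 0 * ∑ α, ∑ β, G x α β * (‖a0‖ * (φ' α).im) * (‖a0‖ * (φ' β).im) := by
        have e1 : ∑ ν, G x 0 ν * (‖a0‖ * (φ' ν).im) = ‖a0‖ * ∑ ν, G x 0 ν * (φ' ν).im := by
          rw [Finset.mul_sum]; exact Finset.sum_congr rfl fun ν _ ↦ by ring
        have e2 : ∑ α, ∑ β, G x α β * (‖a0‖ * (φ' α).im) * (‖a0‖ * (φ' β).im) =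
            ‖a0‖ ^ 2 * symIm := by
          rw [hsymIm, Finset.mul_sum]
          refine Finset.sum_congr rfl fun α _ ↦ ?_
          rw [Finset.mul_sum]
          exact Finset.sum_congr rfl fun β _ ↦ by ring
        rw [e1, e2, hPim, hsymIm]
        ring
      have hb := abs_pform_le G x (hC x hxs) fun ν ↦ ‖a0‖ * (φ' ν).im
      rw [← hv, abs_mul, abs_of_nonneg (by positivity : (0 : ℝ) ≤ ‖a0‖ ^ 2)] at hb
      exact hb.trans (mul_le_mul_of_nonneg_left
        (pow_le_pow_left₀ (Finset.sum_nonneg fun _ _ ↦ abs_nonneg _) hsumv 2) (by positivity))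
    -- (iii) the `O(λ)` term
    have hiii : ‖mid‖ ≤ lam * (2 * Ca * (3 / 2 * C ^ 2 * ((4 * Cφ) * (4 * Ca')))) := by
      have h1 : ‖densC G x φ' (star a')‖ ≤ 3 / 2 * C ^ 2 * ((4 * Cφ) * (4 * Ca')) :=
        (norm_densC_le G x (hC x hxs) φ' (star a')).trans (mul_le_mul_of_nonneg_left
          (mul_le_mul hsumφ hsumas (Finset.sum_nonneg fun _ _ ↦ norm_nonneg _) (by positivity))
          (by positivity))
      have h2 : ‖densC G x a' (star φ')‖ ≤ 3 / 2 * C ^ 2 * ((4 * Cφ) * (4 * Ca')) := by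
        have := (norm_densC_le G x (hC x hxs) a' (star φ')).trans (mul_le_mul_of_nonneg_left
          (mul_le_mul hsuma hsumφs (Finset.sum_nonneg fun _ _ ↦ norm_nonneg _) (by positivity))
          (by positivity))
        calc ‖densC G x a' (star φ')‖ ≤ 3 / 2 * C ^ 2 * ((4 * Ca') * (4 * Cφ)) := this
          _ = 3 / 2 * C ^ 2 * ((4 * Cφ) * (4 * Ca')) := by ring
      have hn1 : ‖I * lam * a0 * densC G x φ' (star a')‖ ≤ lam * (Ca * (3 / 2 * C ^ 2 * ((4 * Cφ) * (4 * Ca')))) := by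
        rw [norm_mul, norm_mul, norm_mul, Complex.norm_I, one_mul, Complex.norm_real,
          Real.norm_eq_abs, abs_of_nonneg hlam, mul_assoc]
        exact mul_le_mul_of_nonneg_left (mul_le_mul ha0 h1 (norm_nonneg _) hCa0) hlam
      have hn2 : ‖I * lam * conj a0 * densC G x a' (star φ')‖ ≤ lam * (Ca * (3 / 2 * C ^ 2 * ((4 * Cφ) * (4 * Ca')))) := by
        rw [norm_mul, norm_mul, norm_mul, Complex.norm_I, one_mul, Complex.norm_real,
          Real.norm_eq_abs, abs_of_nonneg hlam, Complex.norm_conj, mul_assoc]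
        exact mul_le_mul_of_nonneg_left (mul_le_mul ha0 h2 (norm_nonneg _) hCa0) hlam
      calc ‖mid‖ ≤ ‖I * lam * a0 * densC G x φ' (star a')‖ + ‖I * lam * conj a0 * densC G x a' (star φ')‖ :=
            norm_sub_le _ _
        _ ≤ _ := by linarith
    -- (iv) the `O(1)` term
    have hiv : ‖last‖ ≤ 3 / 2 * C ^ 2 * ((4 * Ca') * (4 * Ca')) :=
      (norm_densC_le G x (hC x hxs) a' (star a')).trans (mul_le_mul_of_nonneg_left
        (mul_le_mul hsuma hsumas (Finset.sum_nonneg fun _ _ ↦ norm_nonneg _) (by positivity))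
        (by positivity))
    -- assemble
    have hG00 : |G x 0 0| ≤ C := hC x hxs 0 0
    have hmain : |lam ^ 2 * ‖a0‖ ^ 2 * (-(2⁻¹ * G x 0 0 * symRe) + Pim)| ≤
        lam ^ 2 * (2 * C ^ 2 * (4 * Dφ) ^ 2 * ‖y - D.c t‖ ^ 2 + 2⁻¹ * C * (Ca * D₁) * ‖y - D.c t‖ ^ 3) := by
      rw [show lam ^ 2 * ‖a0‖ ^ 2 * (-(2⁻¹ * G x 0 0 * symRe) + Pim) =
          lam ^ 2 * (‖a0‖ ^ 2 * (-(2⁻¹ * G x 0 0 * symRe) + Pim)) by ring, abs_mul,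
        abs_of_nonneg (sq_nonneg lam)]
      refine mul_le_mul_of_nonneg_left ?_ (sq_nonneg lam)
      rw [abs_mul, abs_of_nonneg (by positivity : (0 : ℝ) ≤ ‖a0‖ ^ 2)]
      have hsr : |symRe| ≤ |(symbolC G x φ' φ').re| + |symIm| := by
        rw [hsymsplit]; exact abs_add_le _ _
      have hstep : ‖a0‖ ^ 2 * |-(2⁻¹ * G x 0 0 * symRe) + Pim| ≤
          2⁻¹ * C * (Ca * (D₁ * ‖y - D.c t‖ ^ 3) + C * (4 * (Dφ * ‖y - D.c t‖)) ^ 2) +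
            3 / 2 * C ^ 2 * (4 * (Dφ * ‖y - D.c t‖)) ^ 2 := by
        have e : ‖a0‖ ^ 2 * |-(2⁻¹ * G x 0 0 * symRe) + Pim| ≤
            2⁻¹ * |G x 0 0| * (‖a0‖ ^ 2 * |symRe|) + ‖a0‖ ^ 2 * |Pim| := by
          calc ‖a0‖ ^ 2 * |-(2⁻¹ * G x 0 0 * symRe) + Pim|
              ≤ ‖a0‖ ^ 2 * (|-(2⁻¹ * G x 0 0 * symRe)| + |Pim|) :=
                mul_le_mul_of_nonneg_left (abs_add_le _ _) (by positivity)
            _ = 2⁻¹ * |G x 0 0| * (‖a0‖ ^ 2 * |symRe|) + ‖a0‖ ^ 2 * |Pim| := by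
                rw [abs_neg, abs_mul, abs_mul, abs_of_pos (by norm_num : (0 : ℝ) < 2⁻¹)]; ring
        have f : ‖a0‖ ^ 2 * |symRe| ≤ Ca * (D₁ * ‖y - D.c t‖ ^ 3) + C * (4 * (Dφ * ‖y - D.c t‖)) ^ 2 := by
          calc ‖a0‖ ^ 2 * |symRe| ≤ ‖a0‖ ^ 2 * (|(symbolC G x φ' φ').re| + |symIm|) :=
                mul_le_mul_of_nonneg_left hsr (by positivity)
            _ = ‖a0‖ ^ 2 * |(symbolC G x φ' φ').re| + ‖a0‖ ^ 2 * |symIm| := by ring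
            _ ≤ _ := add_le_add hi1 hi2
        have g : 2⁻¹ * |G x 0 0| * (‖a0‖ ^ 2 * |symRe|) ≤
            2⁻¹ * C * (Ca * (D₁ * ‖y - D.c t‖ ^ 3) + C * (4 * (Dφ * ‖y - D.c t‖)) ^ 2) :=
          mul_le_mul (mul_le_mul_of_nonneg_left hG00 (by norm_num)) f (by positivity) (by positivity)
        linarith
      calc ‖a0‖ ^ 2 * |-(2⁻¹ * G x 0 0 * symRe) + Pim| ≤ _ := hstep
        _ = 2 * C ^ 2 * (4 * Dφ) ^ 2 * ‖y - D.c t‖ ^ 2 + 2⁻¹ * C * (Ca * D₁) * ‖y - D.c t‖ ^ 3 := by ring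
    calc |lam ^ 2 * ‖a0‖ ^ 2 * (-(2⁻¹ * G x 0 0 * symRe) + Pim) + mid.re + last.re|
        ≤ |lam ^ 2 * ‖a0‖ ^ 2 * (-(2⁻¹ * G x 0 0 * symRe) + Pim)| + |mid.re| + |last.re| :=
          (abs_add_le _ _).trans (add_le_add (abs_add_le _ _) le_rfl)
      _ ≤ lam ^ 2 * (2 * C ^ 2 * (4 * Dφ) ^ 2 * ‖y - D.c t‖ ^ 2 + 2⁻¹ * C * (Ca * D₁) * ‖y - D.c t‖ ^ 3) +
            lam * (2 * Ca * (3 / 2 * C ^ 2 * ((4 * Cφ) * (4 * Ca')))) + 3 / 2 * C ^ 2 * ((4 * Ca') * (4 * Ca')) :=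
          add_le_add (add_le_add hmain ((Complex.abs_re_le_norm _).trans hiii))
            ((Complex.abs_re_le_norm _).trans hiv)
  · -- off the support everything vanishes
    have h1 : A.densH lam x = 0 := A.densH_eq_zero lam hxs
    have h2 : A.amp x = 0 := image_eq_zero_of_notMem_tsupport hxs
    simp only [h1, h2, Complex.zero_re, norm_zero]
    have : 0 ≤ lam ^ 2 * (2 * C ^ 2 * (4 * Dφ) ^ 2 * ‖y - D.c t‖ ^ 2 +
        2⁻¹ * C * (Ca * D₁) * ‖y - D.c t‖ ^ 3) +
        lam * (2 * Ca * (3 / 2 * C ^ 2 * ((4 * Cφ) * (4 * Ca')))) + 3 / 2 * C ^ 2 * ((4 * Ca') * (4 * Ca')) := by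
      positivity
    simpa using this

end BeamAmp

/-! ### Leaf integrals dominated by Gaussian polynomial moments -/

section Dominated

open Literature.Analysis.Asymptotics.GaussianBeam

/-- **Leaf bound for a function dominated by a cubic Gaussian polynomial**: if
`|F(y)| ≤ e^{-2μ‖y−y₀‖²} (b₀ + b₁‖y−y₀‖ + b₂‖y−y₀‖² + b₃‖y−y₀‖³)` with `μ > 0`, then
`|∫ F| ≤ ∑ bₘ (√μ)⁻¹^{m+3} Iₘ`, `Iₘ = ∫ ‖z‖^m e^{-2‖z‖²}`. [cite: Sbierski2015, §4 (proof of the theorem)] -/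
theorem abs_integral_le_of_abs_le_poly3 {F : E3 → ℝ} (y₀ : E3) {μ b₀ b₁ b₂ b₃ : ℝ} (hμ : 0 < μ)
    (hF : ∀ y, |F y| ≤ Real.exp (-2 * μ * ‖y - y₀‖ ^ 2) *
      (b₀ + b₁ * ‖y - y₀‖ + b₂ * ‖y - y₀‖ ^ 2 + b₃ * ‖y - y₀‖ ^ 3)) :
    |∫ y, F y| ≤
      b₀ * ((√μ)⁻¹ ^ (0 + 3) * ∫ z : E3, ‖z‖ ^ 0 * Real.exp (-2 * ‖z‖ ^ 2)) +
      b₁ * ((√μ)⁻¹ ^ (1 + 3) * ∫ z : E3, ‖z‖ ^ 1 * Real.exp (-2 * ‖z‖ ^ 2)) +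
      b₂ * ((√μ)⁻¹ ^ (2 + 3) * ∫ z : E3, ‖z‖ ^ 2 * Real.exp (-2 * ‖z‖ ^ 2)) +
      b₃ * ((√μ)⁻¹ ^ (3 + 3) * ∫ z : E3, ‖z‖ ^ 3 * Real.exp (-2 * ‖z‖ ^ 2)) := by
  have hd : Module.finrank ℝ E3 = 3 := finrank_euclideanSpace_fin
  set g : ℕ → E3 → ℝ := fun m y ↦ ‖y - y₀‖ ^ m * Real.exp (-2 * μ * ‖y - y₀‖ ^ 2) with hg
  have hgi : ∀ m, Integrable (g m) := fun m ↦ integrable_norm_sub_pow_mul_exp y₀ m hμ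
  have hgv : ∀ m, ∫ y, g m y = (√μ)⁻¹ ^ (m + 3) * ∫ z : E3, ‖z‖ ^ m * Real.exp (-2 * ‖z‖ ^ 2) := by
    intro m
    have := integral_norm_sub_pow_mul_exp y₀ m hμ (V := E3)
    rw [hd] at this
    exact this
  have hpt : ∀ y, |F y| ≤ b₀ * g 0 y + b₁ * g 1 y + b₂ * g 2 y + b₃ * g 3 y := by
    intro y
    refine (hF y).trans (le_of_eq ?_)
    simp only [hg, pow_zero, one_mul, pow_one]
    ring
  have hmodel : Integrable fun y ↦ b₀ * g 0 y + b₁ * g 1 y + b₂ * g 2 y + b₃ * g 3 y :=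
    ((((hgi 0).const_mul b₀).add ((hgi 1).const_mul b₁)).add ((hgi 2).const_mul b₂)).add
      ((hgi 3).const_mul b₃)
  have hval : ∫ y, (b₀ * g 0 y + b₁ * g 1 y + b₂ * g 2 y + b₃ * g 3 y) =
      b₀ * (∫ y, g 0 y) + b₁ * (∫ y, g 1 y) + b₂ * (∫ y, g 2 y) + b₃ * (∫ y, g 3 y) := by
    have i0 : Integrable fun y ↦ b₀ * g 0 y := (hgi 0).const_mul b₀
    have i1 : Integrable fun y ↦ b₁ * g 1 y := (hgi 1).const_mul b₁
    have i2 : Integrable fun y ↦ b₂ * g 2 y := (hgi 2).const_mul b₂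
    have i3 : Integrable fun y ↦ b₃ * g 3 y := (hgi 3).const_mul b₃
    have i01 : Integrable fun y ↦ b₀ * g 0 y + b₁ * g 1 y := i0.add i1
    have i012 : Integrable fun y ↦ b₀ * g 0 y + b₁ * g 1 y + b₂ * g 2 y := i01.add i2
    rw [MeasureTheory.integral_add i012 i3, MeasureTheory.integral_add i01 i2,
      MeasureTheory.integral_add i0 i1, MeasureTheory.integral_const_mul, MeasureTheory.integral_const_mul,
      MeasureTheory.integral_const_mul, MeasureTheory.integral_const_mul]
  have hpt' : ∀ᵐ y ∂volume, ‖F y‖ ≤ b₀ * g 0 y + b₁ * g 1 y + b₂ * g 2 y + b₃ * g 3 y :=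
    Eventually.of_forall fun y ↦ (Real.norm_eq_abs _).le.trans (hpt y)
  calc |∫ y, F y| = ‖∫ y, F y‖ := (Real.norm_eq_abs _).symm
    _ ≤ ∫ y, (b₀ * g 0 y + b₁ * g 1 y + b₂ * g 2 y + b₃ * g 3 y) := norm_integral_le_of_norm_le hmodel hpt'
    _ = _ := by rw [hval]; simp only [hgv]

end Dominated

/-! ### The main term `λ² ∫ e^{-2λφ₂} |a|² T²` and the flux `λ² ∫ e^{-2λφ₂} |a|² T` -/

namespace BeamAmp

open Literature.Analysis.Asymptotics.GaussianBeam

variable {G : E4 → Fin 4 → Fin 4 → ℝ} {V : Set E4} {J : Set ℝ} {D : BeamData G V J} {T : ℝ}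
  (A : BeamAmp D T)

/-- `|a|² = ‖a‖²` as a `C^∞` function. [folklore] -/
def nsq (x : E4) : ℝ := ‖A.amp x‖ ^ 2

/-- `|a|² = ‖a‖²`. [folklore] -/
theorem nsq_eq (x : E4) : A.nsq x = ‖A.amp x‖ ^ 2 := rfl

/-- `|a|² ≥ 0`. [folklore] -/
theorem nsq_nonneg (x : E4) : 0 ≤ A.nsq x := sq_nonneg _

/-- `|a|²` is `C^∞`. [folklore] -/
theorem contDiff_nsq : ContDiff ℝ ∞ A.nsq := (contDiff_norm_sq ℝ).comp A.smooth

/-- `|a|²` vanishes off `supp a`; its support lies in `supp a`. [folklore] -/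
theorem tsupport_nsq_subset : tsupport A.nsq ⊆ tsupport A.amp :=
  closure_minimal (fun x hx ↦ by
    by_contra h
    exact hx (by simp [nsq, image_eq_zero_of_notMem_tsupport h])) (isClosed_tsupport _)

/-- `W^μ(x) = ∑_ν G^{μν}(x) Re ∂_νφ(x)` — the components of `grad φ₁`; `W⁰ = T`. [cite: Sbierski2015, §4 (the current `X`)] -/
def _root_.Literature.Geometry.Lorentzian.GaussianBeam.BeamData.Wc (D : BeamData G V J)
    (μ : Fin 4) (x : E4) : ℝ := ∑ ν, G x μ ν * (dC D.φ x ν).re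

/-- `W⁰ = T`. [folklore] -/
theorem _root_.Literature.Geometry.Lorentzian.GaussianBeam.BeamData.Wc_zero (D : BeamData G V J)
    (x : E4) : D.Wc 0 x = D.tCo x := rfl

/-- `W^μ` is `C^∞` on `V ∩ {x⁰ ∈ J}`. [folklore] -/
theorem _root_.Literature.Geometry.Lorentzian.GaussianBeam.BeamData.contDiffOn_Wc (D : BeamData G V J)
    (μ : Fin 4) : ContDiffOn ℝ ∞ (D.Wc μ) (V ∩ {x : E4 | x 0 ∈ J}) :=
  ContDiffOn.sum fun ν _ ↦ ((D.hG μ ν).mono inter_subset_left).mul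
    ((Complex.reCLM.contDiff.comp_contDiffOn (D.contDiffOn_dC_φ ν)).mono inter_subset_right)

/-- The Gaussian weight `e^{-2λ Im φ}`, `C^∞` on the slab. [cite: Sbierski2015, §3] -/
def _root_.Literature.Geometry.Lorentzian.GaussianBeam.BeamData.gw (D : BeamData G V J)
    (lam : ℝ) (x : E4) : ℝ := Real.exp (-2 * lam * (D.φ x).im)

/-- The weight is `C^∞` on the slab. [folklore] -/
theorem _root_.Literature.Geometry.Lorentzian.GaussianBeam.BeamData.contDiffOn_gw (D : BeamData G V J)
    (lam : ℝ) : ContDiffOn ℝ ∞ (D.gw lam) {x : E4 | x 0 ∈ J} :=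
  Real.contDiff_exp.comp_contDiffOn (contDiffOn_const.mul
    (Complex.imCLM.contDiff.comp_contDiffOn D.contDiffOn_φ))

/-- The weight is positive. [folklore] -/
theorem _root_.Literature.Geometry.Lorentzian.GaussianBeam.BeamData.gw_pos (D : BeamData G V J)
    (lam : ℝ) (x : E4) : 0 < D.gw lam x := Real.exp_pos _

/-- `Q^μ = |a|² W^μ`, `C^∞` and compactly supported. [cite: Sbierski2015, §4 (the current `X`)] -/
def Qc (μ : Fin 4) (x : E4) : ℝ := A.nsq x * D.Wc μ x

/-- `Q^μ` is `C^∞`. [folklore] -/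
theorem contDiff_Qc (μ : Fin 4) : ContDiff ℝ ∞ (A.Qc μ) :=
  contDiff_mul_of_tsupport D.isOpen_inter_slab A.contDiff_nsq (A.tsupport_nsq_subset.trans A.tsupp)
    (D.contDiffOn_Wc μ)

/-- `Q^μ` vanishes off `supp a`. [folklore] -/
theorem Qc_eq_zero (μ : Fin 4) {x : E4} (hx : x ∉ tsupport A.amp) : A.Qc μ x = 0 := by
  simp [Qc, nsq, image_eq_zero_of_notMem_tsupport hx]

/-- `supp Q^μ ⊆ supp a`. [folklore] -/
theorem tsupport_Qc_subset (μ : Fin 4) : tsupport (A.Qc μ) ⊆ tsupport A.amp :=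
  closure_minimal (fun x hx ↦ by by_contra h; exact hx (A.Qc_eq_zero μ h)) (isClosed_tsupport _)

/-- **The main density** `e^{-2λφ₂} |a|² T²` and **the flux density** `e^{-2λφ₂} |a|² T` (the
`n`-component of Sbierski's current `X/λ²`). [cite: Sbierski2015, §4 (proof of the theorem)] -/
def mdens (lam : ℝ) (x : E4) : ℝ := D.gw lam x * (A.nsq x * D.tCo x ^ 2)

/-- The flux density `e^{-2λφ₂} |a|² T = e^{-2λφ₂} Q⁰`. [cite: Sbierski2015, §4 (proof of the theorem)] -/
def fdens (lam : ℝ) (x : E4) : ℝ := D.gw lam x * A.Qc 0 x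

/-- The main density is `C^∞`. [folklore] -/
theorem contDiff_mdens (lam : ℝ) : ContDiff ℝ ∞ (A.mdens lam) := by
  have h : ContDiff ℝ ∞ fun x ↦ A.nsq x * D.tCo x ^ 2 :=
    contDiff_mul_of_tsupport D.isOpen_inter_slab A.contDiff_nsq (A.tsupport_nsq_subset.trans A.tsupp)
      ((D.contDiffOn_Wc 0).pow 2)
  have hts : tsupport (fun x ↦ A.nsq x * D.tCo x ^ 2) ⊆ {x : E4 | x 0 ∈ J} :=
    (closure_minimal (fun x hx ↦ by
      by_contra h'
      exact hx (by simp [nsq, image_eq_zero_of_notMem_tsupport h'])) (isClosed_tsupport _)).trans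
      A.tsupp_slab
  exact contDiff_mul_of_tsupport' (isOpen_slab D.hJ) h hts (D.contDiffOn_gw lam)

/-- The flux density is `C^∞`. [folklore] -/
theorem contDiff_fdens (lam : ℝ) : ContDiff ℝ ∞ (A.fdens lam) :=
  contDiff_mul_of_tsupport' (isOpen_slab D.hJ) (A.contDiff_Qc 0)
    ((A.tsupport_Qc_subset 0).trans A.tsupp_slab) (D.contDiffOn_gw lam)

/-- The main density vanishes off `supp a`. [folklore] -/
theorem mdens_eq_zero (lam : ℝ) {x : E4} (hx : x ∉ tsupport A.amp) : A.mdens lam x = 0 := by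
  simp [mdens, nsq, image_eq_zero_of_notMem_tsupport hx]

/-- The flux density vanishes off `supp a`. [folklore] -/
theorem fdens_eq_zero (lam : ℝ) {x : E4} (hx : x ∉ tsupport A.amp) : A.fdens lam x = 0 := by
  simp [fdens, A.Qc_eq_zero 0 hx]

/-- The main density has compact support. [folklore] -/
theorem hasCompactSupport_mdens (lam : ℝ) : HasCompactSupport (A.mdens lam) :=
  IsCompact.of_isClosed_subset A.compact (isClosed_tsupport _)
    (closure_minimal (fun x hx ↦ by by_contra h; exact hx (A.mdens_eq_zero lam h)) (isClosed_tsupport _))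

/-- The flux density has compact support. [folklore] -/
theorem hasCompactSupport_fdens (lam : ℝ) : HasCompactSupport (A.fdens lam) :=
  IsCompact.of_isClosed_subset A.compact (isClosed_tsupport _)
    (closure_minimal (fun x hx ↦ by by_contra h; exact hx (A.fdens_eq_zero lam h)) (isClosed_tsupport _))

/-- **The weighted remainder is small after integration over the leaf**: for `λ ≥ 1` and every `τ`,
`|∫ wdensH(τ,·) − λ² ∫ mdens(τ,·)| ≤ K (√λ)⁻¹`. [cite: Sbierski2015, §4 (proof of the theorem: "lower order terms `= O(1)`")] -/
theorem exists_wdensH_sub_main_bound : ∃ K : ℝ, 0 ≤ K ∧ ∀ lam : ℝ, 1 ≤ lam → ∀ τ : ℝ,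
    |(∫ y, A.wdensH lam (E4.ofTimeSpace τ y)) - lam ^ 2 * ∫ y, A.mdens lam (E4.ofTimeSpace τ y)| ≤
      K * (√lam)⁻¹ := by
  obtain ⟨K₀, K₁, K₂, K₃, hK₀, hK₁, hK₂, hK₃, hR⟩ := A.exists_densH_remainder_bound
  obtain ⟨c₀, hc₀, hIm⟩ := A.exists_pos_le_im_φ
  set I0 : ℝ := ∫ z : E3, ‖z‖ ^ 0 * Real.exp (-2 * ‖z‖ ^ 2) with hI0
  set I2 : ℝ := ∫ z : E3, ‖z‖ ^ 2 * Real.exp (-2 * ‖z‖ ^ 2) with hI2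
  set I3 : ℝ := ∫ z : E3, ‖z‖ ^ 3 * Real.exp (-2 * ‖z‖ ^ 2) with hI3
  have hI0n : 0 ≤ I0 := integral_norm_pow_mul_exp_neg_two_mul_sq_nonneg 0
  have hI2n : 0 ≤ I2 := integral_norm_pow_mul_exp_neg_two_mul_sq_nonneg 2
  have hI3n : 0 ≤ I3 := integral_norm_pow_mul_exp_neg_two_mul_sq_nonneg 3
  have hsc : 0 < (√c₀)⁻¹ := inv_pos.2 (Real.sqrt_pos.2 hc₀)
  refine ⟨(K₁ + K₀) * ((√c₀)⁻¹ ^ 3 * I0) + K₂ * ((√c₀)⁻¹ ^ 5 * I2) + K₃ * ((√c₀)⁻¹ ^ 6 * I3),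
    by positivity, fun lam hlam τ ↦ ?_⟩
  have hlam0 : 0 < lam := one_pos.trans_le hlam
  have hsl : √lam * √lam = lam := Real.mul_self_sqrt hlam0.le
  have hsl1 : 1 ≤ √lam := by rw [← Real.sqrt_one]; exact Real.sqrt_le_sqrt hlam
  have hsl0 : 0 < √lam := one_pos.trans_le hsl1
  have hs1 : (√lam)⁻¹ ≤ 1 := inv_le_one_of_one_le₀ hsl1
  have hs0 : 0 ≤ (√lam)⁻¹ := inv_nonneg.2 hsl0.le
  -- the integrals combine into one
  have hint : (∫ y, A.wdensH lam (E4.ofTimeSpace τ y)) - lam ^ 2 * ∫ y, A.mdens lam (E4.ofTimeSpace τ y) =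
      ∫ y, (A.wdensH lam (E4.ofTimeSpace τ y) - lam ^ 2 * A.mdens lam (E4.ofTimeSpace τ y)) := by
    rw [integral_sub, integral_const_mul]
    · exact integrable_slice (A.contDiff_wdensH lam).continuous (A.hasCompactSupport_wdensH lam) τ
    · exact (integrable_slice (A.contDiff_mdens lam).continuous (A.hasCompactSupport_mdens lam) τ).const_mul _
  rw [hint]
  by_cases hτ : τ ∈ A.timeHull
  · -- pointwise domination
    have hpt : ∀ y, |A.wdensH lam (E4.ofTimeSpace τ y) - lam ^ 2 * A.mdens lam (E4.ofTimeSpace τ y)| ≤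
        Real.exp (-2 * (lam * c₀) * ‖y - D.c τ‖ ^ 2) *
          ((lam * K₁ + K₀) + 0 * ‖y - D.c τ‖ + lam ^ 2 * K₂ * ‖y - D.c τ‖ ^ 2 +
            lam ^ 2 * K₃ * ‖y - D.c τ‖ ^ 3) := by
      intro y
      set x := E4.ofTimeSpace τ y with hx
      have hfac : A.wdensH lam x - lam ^ 2 * A.mdens lam x =
          D.gw lam x * ((A.densH lam x).re - lam ^ 2 * ‖A.amp x‖ ^ 2 * D.tCo x ^ 2) := by
        simp only [wdensH, mdens, BeamData.gw, A.nsq_eq]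
        ring
      rw [hfac, abs_mul, abs_of_pos (D.gw_pos lam x)]
      have hw : D.gw lam x ≤ Real.exp (-2 * (lam * c₀) * ‖y - D.c τ‖ ^ 2) := by
        have him := hIm x (by simpa [hx] using hτ)
        simp only [hx, E4.spatial_ofTimeSpace, E4.ofTimeSpace_apply_zero] at him
        unfold BeamData.gw
        apply Real.exp_le_exp.2
        have : 0 ≤ lam := hlam0.le
        nlinarith
      have hRb := hR lam hlam0.le τ hτ y
      calc D.gw lam x * |(A.densH lam x).re - lam ^ 2 * ‖A.amp x‖ ^ 2 * D.tCo x ^ 2|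
          ≤ Real.exp (-2 * (lam * c₀) * ‖y - D.c τ‖ ^ 2) *
              (lam ^ 2 * (K₂ * ‖y - D.c τ‖ ^ 2 + K₃ * ‖y - D.c τ‖ ^ 3) + lam * K₁ + K₀) :=
            mul_le_mul hw hRb (abs_nonneg _) (Real.exp_nonneg _)
        _ = _ := by ring
    have hmain := abs_integral_le_of_abs_le_poly3 (D.c τ) (mul_pos hlam0 hc₀) hpt
    refine hmain.trans ?_
    rw [Real.sqrt_mul hlam0.le, mul_inv, mul_pow, mul_pow, mul_pow, mul_pow, ← hI0, ← hI2, ← hI3]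
    simp only [zero_mul, zero_add, zero_mul, add_zero]
    -- powers of `(√λ)⁻¹`
    have h3 : (lam * K₁ + K₀) * ((√lam)⁻¹ ^ (0 + 3) * (√c₀)⁻¹ ^ (0 + 3) * I0) ≤
        (K₁ + K₀) * ((√c₀)⁻¹ ^ 3 * I0) * (√lam)⁻¹ := by
      have e : (√lam)⁻¹ ^ (0 + 3) = (√lam)⁻¹ * ((√lam)⁻¹ * (√lam)⁻¹) := by ring
      have hll : lam * ((√lam)⁻¹ * (√lam)⁻¹) = 1 := by
        rw [← mul_inv, hsl]; exact mul_inv_cancel₀ hlam0.ne'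
      have hK : (lam * K₁ + K₀) * ((√lam)⁻¹ * (√lam)⁻¹) ≤ K₁ + K₀ := by
        have : K₀ * ((√lam)⁻¹ * (√lam)⁻¹) ≤ K₀ := by
          calc K₀ * ((√lam)⁻¹ * (√lam)⁻¹) ≤ K₀ * 1 := by gcongr; nlinarith
            _ = K₀ := mul_one _
        nlinarith
      calc (lam * K₁ + K₀) * ((√lam)⁻¹ ^ (0 + 3) * (√c₀)⁻¹ ^ (0 + 3) * I0)
          = ((lam * K₁ + K₀) * ((√lam)⁻¹ * (√lam)⁻¹)) * ((√c₀)⁻¹ ^ 3 * I0) * (√lam)⁻¹ := by rw [e]; ring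
        _ ≤ (K₁ + K₀) * ((√c₀)⁻¹ ^ 3 * I0) * (√lam)⁻¹ := by gcongr
    have h5 : lam ^ 2 * K₂ * ((√lam)⁻¹ ^ (2 + 3) * (√c₀)⁻¹ ^ (2 + 3) * I2) ≤
        K₂ * ((√c₀)⁻¹ ^ 5 * I2) * (√lam)⁻¹ := by
      have e : lam ^ 2 * (√lam)⁻¹ ^ (2 + 3) = (√lam)⁻¹ := by
        rw [show (√lam)⁻¹ ^ (2 + 3) = ((√lam)⁻¹ * (√lam)⁻¹) ^ 2 * (√lam)⁻¹ by ring, ← mul_inv, hsl,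
          inv_pow, ← mul_assoc, mul_inv_cancel₀ (by positivity), one_mul]
      have : lam ^ 2 * K₂ * ((√lam)⁻¹ ^ (2 + 3) * (√c₀)⁻¹ ^ (2 + 3) * I2) =
          K₂ * ((√c₀)⁻¹ ^ 5 * I2) * (lam ^ 2 * (√lam)⁻¹ ^ (2 + 3)) := by ring
      rw [this, e]
    have h6 : lam ^ 2 * K₃ * ((√lam)⁻¹ ^ (3 + 3) * (√c₀)⁻¹ ^ (3 + 3) * I3) ≤
        K₃ * ((√c₀)⁻¹ ^ 6 * I3) * (√lam)⁻¹ := by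
      have e : lam ^ 2 * (√lam)⁻¹ ^ (3 + 3) = (√lam)⁻¹ * (√lam)⁻¹ := by
        rw [show (√lam)⁻¹ ^ (3 + 3) = ((√lam)⁻¹ * (√lam)⁻¹) ^ 2 * ((√lam)⁻¹ * (√lam)⁻¹) by ring,
          ← mul_inv, hsl, inv_pow, ← mul_assoc, mul_inv_cancel₀ (by positivity), one_mul]
      have hle : (√lam)⁻¹ * (√lam)⁻¹ ≤ (√lam)⁻¹ := mul_le_of_le_one_right hs0 hs1
      have : lam ^ 2 * K₃ * ((√lam)⁻¹ ^ (3 + 3) * (√c₀)⁻¹ ^ (3 + 3) * I3) =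
          K₃ * ((√c₀)⁻¹ ^ 6 * I3) * (lam ^ 2 * (√lam)⁻¹ ^ (3 + 3)) := by ring
      rw [this, e]
      exact mul_le_mul_of_nonneg_left hle (by positivity)
    linarith
  · -- the slice does not meet the beam
    have hzero : ∀ y, A.wdensH lam (E4.ofTimeSpace τ y) - lam ^ 2 * A.mdens lam (E4.ofTimeSpace τ y) = 0 := by
      intro y
      have hx : E4.ofTimeSpace τ y ∉ tsupport A.amp := fun h ↦ hτ (by simpa using A.mem_timeHull_of_mem_tsupport h)
      simp [wdensH, A.densH_eq_zero lam hx, A.mdens_eq_zero lam hx]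
    have hI : ∫ y, (A.wdensH lam (E4.ofTimeSpace τ y) - lam ^ 2 * A.mdens lam (E4.ofTimeSpace τ y)) = 0 := by
      simp [hzero]
    rw [hI, abs_zero]
    positivity

/-- **The main term against the flux** on a leaf where `|T − κ(τ)| ≤ δ ≤ κ(τ)` on the beam:
`|∫ mdens(τ,·) − κ(τ) ∫ fdens(τ,·)| ≤ δ ∫ fdens(τ,·)`, and `∫ fdens(τ,·) ≥ 0` (Sbierski:
"`|Nφ₁(x) − Nφ₁|_{γ_τ}| ≤ δ` for `x ∈ Σ_τ ∩ 𝒩₁`"). [cite: Sbierski2015, §4 (proof of the theorem, (appcons) ff.)] -/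
theorem abs_integral_mdens_sub_le (lam : ℝ) {τ δ : ℝ} (hδκ : δ ≤ D.κ τ)
    (hδ : ∀ y : E3, E4.ofTimeSpace τ y ∈ tsupport A.amp → |D.tCo (E4.ofTimeSpace τ y) - D.κ τ| ≤ δ) :
    |(∫ y, A.mdens lam (E4.ofTimeSpace τ y)) - D.κ τ * ∫ y, A.fdens lam (E4.ofTimeSpace τ y)| ≤
        δ * ∫ y, A.fdens lam (E4.ofTimeSpace τ y) ∧
      0 ≤ ∫ y, A.fdens lam (E4.ofTimeSpace τ y) := by
  have hT0 : ∀ y, E4.ofTimeSpace τ y ∈ tsupport A.amp → 0 ≤ D.tCo (E4.ofTimeSpace τ y) := by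
    intro y hy
    have := abs_le.1 (hδ y hy)
    linarith [this.1]
  have hf0 : ∀ y, 0 ≤ A.fdens lam (E4.ofTimeSpace τ y) := by
    intro y
    by_cases hy : E4.ofTimeSpace τ y ∈ tsupport A.amp
    · unfold fdens Qc
      have := hT0 y hy
      have hn : 0 ≤ A.nsq (E4.ofTimeSpace τ y) := A.nsq_nonneg _
      exact mul_nonneg (D.gw_pos lam _).le (mul_nonneg hn (by simpa [BeamData.Wc_zero] using this))
    · rw [A.fdens_eq_zero lam hy]
  have hfi : Integrable fun y ↦ A.fdens lam (E4.ofTimeSpace τ y) :=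
    integrable_slice (A.contDiff_fdens lam).continuous (A.hasCompactSupport_fdens lam) τ
  have hmi : Integrable fun y ↦ A.mdens lam (E4.ofTimeSpace τ y) :=
    integrable_slice (A.contDiff_mdens lam).continuous (A.hasCompactSupport_mdens lam) τ
  refine ⟨?_, integral_nonneg hf0⟩
  have hpt : ∀ y, |A.mdens lam (E4.ofTimeSpace τ y) - D.κ τ * A.fdens lam (E4.ofTimeSpace τ y)| ≤
      δ * A.fdens lam (E4.ofTimeSpace τ y) := by
    intro y
    by_cases hy : E4.ofTimeSpace τ y ∈ tsupport A.amp
    · set x := E4.ofTimeSpace τ y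
      have hfac : A.mdens lam x - D.κ τ * A.fdens lam x =
          D.gw lam x * A.nsq x * D.tCo x * (D.tCo x - D.κ τ) := by
        simp only [mdens, fdens, Qc, D.Wc_zero]; ring
      have hfd : A.fdens lam x = D.gw lam x * A.nsq x * D.tCo x := by
        simp only [fdens, Qc, D.Wc_zero]; ring
      have hnn : 0 ≤ D.gw lam x * A.nsq x * D.tCo x :=
        mul_nonneg (mul_nonneg (D.gw_pos lam x).le (A.nsq_nonneg _)) (hT0 y hy)
      rw [hfac, hfd, abs_mul, abs_of_nonneg hnn]
      calc D.gw lam x * A.nsq x * D.tCo x * |D.tCo x - D.κ τ| ≤ D.gw lam x * A.nsq x * D.tCo x * δ :=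
            mul_le_mul_of_nonneg_left (hδ y hy)
              (mul_nonneg (mul_nonneg (D.gw_pos lam x).le (A.nsq_nonneg _)) (hT0 y hy))
        _ = δ * (D.gw lam x * A.nsq x * D.tCo x) := by ring
    · simp [A.mdens_eq_zero lam hy, A.fdens_eq_zero lam hy]
  calc |(∫ y, A.mdens lam (E4.ofTimeSpace τ y)) - D.κ τ * ∫ y, A.fdens lam (E4.ofTimeSpace τ y)|
      = |∫ y, (A.mdens lam (E4.ofTimeSpace τ y) - D.κ τ * A.fdens lam (E4.ofTimeSpace τ y))| := by
        rw [integral_sub hmi (hfi.const_mul _), integral_const_mul]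
    _ = ‖∫ y, (A.mdens lam (E4.ofTimeSpace τ y) - D.κ τ * A.fdens lam (E4.ofTimeSpace τ y))‖ :=
        (Real.norm_eq_abs _).symm
    _ ≤ ∫ y, δ * A.fdens lam (E4.ofTimeSpace τ y) :=
        norm_integral_le_of_norm_le (hfi.const_mul δ)
          (Eventually.of_forall fun y ↦ (Real.norm_eq_abs _).le.trans (hpt y))
    _ = δ * ∫ y, A.fdens lam (E4.ofTimeSpace τ y) := integral_const_mul _ _

end BeamAmp

/-! ### The approximate conservation of the flux -/

namespace BeamAmp

open Literature.Analysis.Asymptotics.GaussianBeam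

variable {G : E4 → Fin 4 → Fin 4 → ℝ} {V : Set E4} {J : Set ℝ} {D : BeamData G V J} {T : ℝ}
  (A : BeamAmp D T)

/-- **Sbierski's current** `X^μ = λ² |a|² e^{-2λφ₂} (grad φ₁)^μ` in components:
`J^μ = λ² e^{-2λ Im φ} Q^μ`. [cite: Sbierski2015, §4 (proof of the theorem: the current `X_{λ,𝒩}`)] -/
def Jcur (lam : ℝ) (μ : Fin 4) (x : E4) : ℝ := lam ^ 2 * (D.gw lam x * A.Qc μ x)

/-- The current is `C^∞`. [folklore] -/
theorem contDiff_Jcur (lam : ℝ) (μ : Fin 4) : ContDiff ℝ ∞ (A.Jcur lam μ) :=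
  contDiff_const.mul (contDiff_mul_of_tsupport' (isOpen_slab D.hJ) (A.contDiff_Qc μ)
    ((A.tsupport_Qc_subset μ).trans A.tsupp_slab) (D.contDiffOn_gw lam))

/-- `J⁰ = λ² fdens`. [folklore] -/
theorem Jcur_zero (lam : ℝ) (x : E4) : A.Jcur lam 0 x = lam ^ 2 * A.fdens lam x := rfl

/-- The current vanishes off `supp a`. [folklore] -/
theorem Jcur_eq_zero (lam : ℝ) (μ : Fin 4) {x : E4} (hx : x ∉ tsupport A.amp) : A.Jcur lam μ x = 0 := by
  simp [Jcur, A.Qc_eq_zero μ hx]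

/-- **The beam lies over a ball**: `‖x⃗‖ ≤ ρ` on `supp a`. [folklore] -/
theorem exists_radius : ∃ ρ : ℝ, ∀ x ∈ tsupport A.amp, ‖E4.spatial x‖ ≤ ρ := by
  obtain ⟨ρ, hρ⟩ := (A.compact.image E4.spatial.continuous).isBounded.exists_norm_le
  exact ⟨ρ, fun x hx ↦ hρ _ ⟨x, hx, rfl⟩⟩

/-- `w₁ = ∑_μ ∂_μ Q^μ` (`= grad φ₁(|a|²) + |a|² □φ₁`, Sbierski's first bracket in `div X`).
[cite: Sbierski2015, §4 (proof of the theorem: `div X_{λ,𝒩}`)] -/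
def w₁ (x : E4) : ℝ := ∑ μ, fderiv ℝ (A.Qc μ) x (E4.basisVector μ)

/-- `w₁` is `C^∞`. [folklore] -/
theorem contDiff_w₁ : ContDiff ℝ ∞ A.w₁ :=
  ContDiff.sum fun μ _ ↦ ((A.contDiff_Qc μ).fderiv_right (m := ∞) le_rfl).clm_apply contDiff_const

/-- `w₁` vanishes off `supp a`. [folklore] -/
theorem w₁_eq_zero {x : E4} (hx : x ∉ tsupport A.amp) : A.w₁ x = 0 := by
  unfold w₁
  refine Finset.sum_eq_zero fun μ _ ↦ ?_
  have hzero : A.Qc μ =ᶠ[𝓝 x] fun _ ↦ 0 := by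
    filter_upwards [(isClosed_tsupport A.amp).isOpen_compl.mem_nhds hx] with y hy using A.Qc_eq_zero μ hy
  rw [hzero.fderiv_eq]
  simp

/-- `w₁` has compact support. [folklore] -/
theorem hasCompactSupport_w₁ : HasCompactSupport A.w₁ :=
  IsCompact.of_isClosed_subset A.compact (isClosed_tsupport _)
    (closure_minimal (fun x hx ↦ by by_contra h; exact hx (A.w₁_eq_zero h)) (isClosed_tsupport _))

/-- The imaginary part of the complex symbol on the diagonal, for symmetric coefficients:
`Im s(ζ, ζ) = 2 ∑ G_{αβ} Re ζ_α Im ζ_β`. [folklore] -/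
theorem im_symbolC_self (x : E4) (hGs : ∀ μ ν, G x μ ν = G x ν μ) (ζ : Fin 4 → ℂ) :
    (symbolC G x ζ ζ).im = 2 * ∑ α, ∑ β, G x α β * (ζ α).re * (ζ β).im := by
  have h1 : (symbolC G x ζ ζ).im = ∑ α, ∑ β, G x α β * ((ζ α).re * (ζ β).im + (ζ α).im * (ζ β).re) := by
    simp only [symbolC, Complex.im_sum, Complex.mul_re, Complex.mul_im, Complex.ofReal_re,
      Complex.ofReal_im, zero_mul, sub_zero, add_zero]
    exact Finset.sum_congr rfl fun α _ ↦ Finset.sum_congr rfl fun β _ ↦ by ring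
  have h2 : ∑ α, ∑ β, G x α β * ((ζ α).im * (ζ β).re) = ∑ α, ∑ β, G x α β * ((ζ α).re * (ζ β).im) := by
    rw [Finset.sum_comm]
    exact Finset.sum_congr rfl fun α _ ↦ Finset.sum_congr rfl fun β _ ↦ by rw [hGs β α]; ring
  have h3 : ∑ α, ∑ β, G x α β * ((ζ α).re * (ζ β).im) = ∑ α, ∑ β, G x α β * (ζ α).re * (ζ β).im :=
    Finset.sum_congr rfl fun α _ ↦ Finset.sum_congr rfl fun β _ ↦ by ring
  rw [h1]
  simp only [mul_add, Finset.sum_add_distrib, h2, h3]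
  ring

/-- **`∑_μ Q^μ ∂_μφ₂ = ½ |a|² Im s(dφ, dφ)`** (`= |a|² grad φ₁(φ₂)`, Sbierski's second bracket).
[cite: Sbierski2015, §4 (proof of the theorem, (secondcons))] -/
theorem sum_Qc_mul_im (x : E4) :
    ∑ μ, A.Qc μ x * (dC D.φ x μ).im = 2⁻¹ * A.nsq x * (symbolC G x (dC D.φ x) (dC D.φ x)).im := by
  rw [im_symbolC_self x (D.hGsymm x)]
  have hL : ∑ μ, A.Qc μ x * (dC D.φ x μ).im =
      ∑ μ, ∑ ν, A.nsq x * (G x μ ν * (dC D.φ x ν).re * (dC D.φ x μ).im) := by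
    refine Finset.sum_congr rfl fun μ _ ↦ ?_
    rw [Qc, BeamData.Wc, Finset.mul_sum, Finset.sum_mul]
    exact Finset.sum_congr rfl fun ν _ ↦ by ring
  have hR : 2⁻¹ * A.nsq x * (2 * ∑ α, ∑ β, G x α β * (dC D.φ x α).re * (dC D.φ x β).im) =
      ∑ α, ∑ β, A.nsq x * (G x α β * (dC D.φ x α).re * (dC D.φ x β).im) := by
    rw [show 2⁻¹ * A.nsq x * (2 * ∑ α, ∑ β, G x α β * (dC D.φ x α).re * (dC D.φ x β).im) =
      A.nsq x * ∑ α, ∑ β, G x α β * (dC D.φ x α).re * (dC D.φ x β).im by ring, Finset.mul_sum]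
    exact Finset.sum_congr rfl fun α _ ↦ by rw [Finset.mul_sum]
  rw [hL, hR, Finset.sum_comm]
  exact Finset.sum_congr rfl fun α _ ↦ Finset.sum_congr rfl fun β _ ↦ by rw [D.hGsymm x β α]

/-- **The divergence of the current**, pointwise:
`∑_μ ∂_μ J^μ = λ² e^{-2λφ₂} (w₁ − 2λ ∑_μ Q^μ ∂_μφ₂)`. [cite: Sbierski2015, §4 (proof of the theorem: `div X_{λ,𝒩}`)] -/
theorem sum_fderiv_Jcur (lam : ℝ) (x : E4) :
    ∑ μ, fderiv ℝ (A.Jcur lam μ) x (E4.basisVector μ) =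
      lam ^ 2 * D.gw lam x * (A.w₁ x - 2 * lam * ∑ μ, A.Qc μ x * (dC D.φ x μ).im) := by
  by_cases hx : x ∈ tsupport A.amp
  · have hxJ : x 0 ∈ J := A.tsupp_slab hx
    have hφd : DifferentiableAt ℝ D.φ x :=
      (D.contDiffOn_φ.contDiffAt ((isOpen_slab D.hJ).mem_nhds hxJ)).differentiableAt (by simp)
    -- the weight
    have hgw : HasFDerivAt (D.gw lam) (D.gw lam x • ((-2 * lam) • (Complex.imCLM.comp (fderiv ℝ D.φ x)))) x := by
      have h1 : HasFDerivAt (fun y ↦ (D.φ y).im) (Complex.imCLM.comp (fderiv ℝ D.φ x)) x :=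
        Complex.imCLM.hasFDerivAt.comp x hφd.hasFDerivAt
      have h2 := (h1.const_mul (-2 * lam)).exp
      exact h2
    have hQ : ∀ μ, HasFDerivAt (A.Qc μ) (fderiv ℝ (A.Qc μ) x) x := fun μ ↦
      ((A.contDiff_Qc μ).differentiable (by simp) x).hasFDerivAt
    have hJ : ∀ μ, fderiv ℝ (A.Jcur lam μ) x (E4.basisVector μ) =
        lam ^ 2 * (D.gw lam x * fderiv ℝ (A.Qc μ) x (E4.basisVector μ) +
          A.Qc μ x * (D.gw lam x * (-2 * lam * (dC D.φ x μ).im))) := by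
      intro μ
      have h := ((hgw.mul (hQ μ)).const_mul (lam ^ 2))
      have h' : HasFDerivAt (A.Jcur lam μ) _ x := h
      rw [h'.fderiv]
      simp [dC, smul_eq_mul]
      ring
    have hR : lam ^ 2 * D.gw lam x * (A.w₁ x - 2 * lam * ∑ μ, A.Qc μ x * (dC D.φ x μ).im) =
        ∑ μ, lam ^ 2 * D.gw lam x *
          (fderiv ℝ (A.Qc μ) x (E4.basisVector μ) - 2 * lam * (A.Qc μ x * (dC D.φ x μ).im)) := by
      rw [w₁, Finset.mul_sum, ← Finset.sum_sub_distrib, Finset.mul_sum]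
    rw [hR]
    exact Finset.sum_congr rfl fun μ _ ↦ by rw [hJ μ]; ring
  · -- off the support both sides vanish
    have hzero : ∀ μ, A.Jcur lam μ =ᶠ[𝓝 x] fun _ ↦ 0 := fun μ ↦ by
      filter_upwards [(isClosed_tsupport A.amp).isOpen_compl.mem_nhds hx] with y hy using A.Jcur_eq_zero lam μ hy
    have h0 : ∀ μ, fderiv ℝ (A.Jcur lam μ) x (E4.basisVector μ) = 0 := fun μ ↦ by
      rw [(hzero μ).fderiv_eq]; simp
    simp only [h0, Finset.sum_const_zero, A.w₁_eq_zero hx, A.Qc_eq_zero _ hx]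
    simp

end BeamAmp

/-! ### `w₁` vanishes on the curve (the real transport law); its flat bound; the flux difference -/

namespace BeamAmp

open Literature.Analysis.Asymptotics.GaussianBeam

variable {G : E4 → Fin 4 → Fin 4 → ℝ} {V : Set E4} {J : Set ℝ} {D : BeamData G V J} {T : ℝ}
  (A : BeamAmp D T)

/-- `W^μ = Re(∑_ν G^{μν} ∂_νφ)` pointwise. [folklore] -/
theorem Wc_eq_re_inner (μ : Fin 4) (x : E4) :
    D.Wc μ x = (∑ ν, (G x μ ν : ℂ) * dC D.φ x ν).re := by
  simp [BeamData.Wc, Complex.re_sum]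

/-- On the curve `W^μ(X(t)) = κ(t) Ẋ^μ(t)`. [cite: Sbierski2015, §4 (proof of the theorem)] -/
theorem _root_.Literature.Geometry.Lorentzian.GaussianBeam.BeamData.Wc_X (D : BeamData G V J)
    {t : ℝ} (ht : t ∈ J) (μ : Fin 4) : D.Wc μ (D.X t) = D.κ t * xdot D.c t μ := by
  have hx0 : (D.X t) 0 ∈ J := by simpa [BeamData.X] using ht
  have hre : ∀ ν, (dC D.φ (D.X t) ν).re = D.P t ν := fun ν ↦ by
    rw [BeamData.φ, dC_phase D.P D.M D.c D.hJ D.hP D.hM D.hc hx0 ν, BeamData.X,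
      dphase_curve D.P D.M D.c t (D.hPX t ht), Complex.ofReal_re]
  simp only [BeamData.Wc, hre]
  simpa [BeamData.X] using D.hvel t ht μ

/-- `∑_μ ∂_μW^μ(X(t)) = Re □φ(X(t)) = Re b(t)`. [cite: Sbierski2015, §4 (proof of the theorem)] -/
theorem _root_.Literature.Geometry.Lorentzian.GaussianBeam.BeamData.sum_fderiv_Wc_X (D : BeamData G V J)
    {t : ℝ} (ht : t ∈ J) :
    ∑ μ, fderiv ℝ (D.Wc μ) (D.X t) (E4.basisVector μ) = (opTrace G D.P D.M D.c t).re := by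
  have hXU : D.X t ∈ V ∩ {x : E4 | x 0 ∈ J} := D.X_mem ht
  have hinner : ∀ μ, fderiv ℝ (D.Wc μ) (D.X t) (E4.basisVector μ) =
      (fderiv ℝ (fun y ↦ ∑ ν, (G y μ ν : ℂ) * dC D.φ y ν) (D.X t) (E4.basisVector μ)).re := by
    intro μ
    have hfun : D.Wc μ = fun y ↦ (∑ ν, (G y μ ν : ℂ) * dC D.φ y ν).re :=
      funext fun x ↦ by simp [BeamData.Wc, Complex.re_sum]
    rw [hfun]
    exact fderiv_re_apply (((D.contDiffOn_inner_φ μ).contDiffAt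
      (D.isOpen_inter_slab.mem_nhds hXU)).differentiableAt (by simp)) _
  simp only [hinner, ← Complex.re_sum]
  have hw : ∑ μ, fderiv ℝ (fun y ↦ ∑ ν, (G y μ ν : ℂ) * dC D.φ y ν) (D.X t) (E4.basisVector μ) =
      waveOperatorC G D.φ (D.X t) := rfl
  rw [hw, BeamData.φ, BeamData.X, waveOperatorC_phase_curve G D.P D.M D.c D.hJ D.hP D.hM D.hc D.hV D.hG ht
    (D.hXV t ht) D.hPX (D.hsymm t ht) (D.hMX t ht)]

/-- The coordinate derivatives of `|a|²` at a curve point of the core range: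
`∂_μ|a|²(X(t)) = δ_{μ0} (|A₀|²)˙(t)`. [folklore] -/
theorem fderiv_nsq_X {t : ℝ} (ht : t ∈ Ioo (-A.η) (T + A.η)) (μ : Fin 4) :
    fderiv ℝ A.nsq (D.X t) (E4.basisVector μ) =
      if μ = 0 then -((opTrace G D.P D.M D.c t).re / D.κ t) * ‖D.A₀ t‖ ^ 2 else 0 := by
  have htJ : t ∈ J := A.Ioo_subset ht
  -- `|a|² = ‖A₀(x⁰)‖²` near `X(t)`
  have hev : A.nsq =ᶠ[𝓝 (D.X t)] fun y ↦ ‖D.A₀ (y 0)‖ ^ 2 :=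
    (A.core t ht).mono fun y hy ↦ by simp [nsq, hy]
  have hder : HasDerivAt (fun u ↦ ‖D.A₀ u‖ ^ 2)
      (-((opTrace G D.P D.M D.c t).re / D.κ t) * ‖D.A₀ t‖ ^ 2) t := by
    have h := D.hasDerivAt_normSq_A₀ htJ
    have hfun : (fun u ↦ Complex.normSq (D.A₀ u)) = fun u ↦ ‖D.A₀ u‖ ^ 2 :=
      funext fun u ↦ Complex.normSq_eq_norm_sq _
    rw [hfun, Complex.normSq_eq_norm_sq] at h
    exact h
  have hcomp : HasFDerivAt (fun y : E4 ↦ ‖D.A₀ (y 0)‖ ^ 2)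
      ((ContinuousLinearMap.smulRight (1 : ℝ →L[ℝ] ℝ)
        (-((opTrace G D.P D.M D.c t).re / D.κ t) * ‖D.A₀ t‖ ^ 2)).comp (E4.dx 0)) (D.X t) := by
    have hx0 : (D.X t) 0 = t := by simp [BeamData.X]
    have hder' : HasDerivAt (fun u ↦ ‖D.A₀ u‖ ^ 2)
        (-((opTrace G D.P D.M D.c t).re / D.κ t) * ‖D.A₀ t‖ ^ 2) ((D.X t) 0) := by rw [hx0]; exact hder
    exact hder'.hasFDerivAt.comp (D.X t) (E4.dx 0).hasFDerivAt
  rw [hev.fderiv_eq, hcomp.fderiv]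
  by_cases hμ : μ = 0
  · subst hμ; simp [E4.basisVector]
  · simp [E4.basisVector, hμ]

/-- **`w₁` vanishes on the curve** over the core range — the real form of the transport equation
`κ (|A₀|²)˙ + Re(□φ) |A₀|² = 0` (Sbierski's (firstcons): "`grad φ(|a|²) = −Re(□φ)|a|²` along
`γ`"). [cite: Sbierski2015, §4 (proof of the theorem, (firstcons))] -/
theorem w₁_X {t : ℝ} (ht : t ∈ Ioo (-A.η) (T + A.η)) : A.w₁ (D.X t) = 0 := by
  have htJ : t ∈ J := A.Ioo_subset ht
  have hXU : D.X t ∈ V ∩ {x : E4 | x 0 ∈ J} := D.X_mem htJ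
  have hprod : ∀ μ, fderiv ℝ (A.Qc μ) (D.X t) (E4.basisVector μ) =
      fderiv ℝ A.nsq (D.X t) (E4.basisVector μ) * D.Wc μ (D.X t) +
        A.nsq (D.X t) * fderiv ℝ (D.Wc μ) (D.X t) (E4.basisVector μ) := by
    intro μ
    have hn : DifferentiableAt ℝ A.nsq (D.X t) := A.contDiff_nsq.differentiable (by simp) _
    have hW : DifferentiableAt ℝ (D.Wc μ) (D.X t) :=
      ((D.contDiffOn_Wc μ).contDiffAt (D.isOpen_inter_slab.mem_nhds hXU)).differentiableAt (by simp)
    have h := hn.hasFDerivAt.mul hW.hasFDerivAt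
    have h' : HasFDerivAt (A.Qc μ) _ (D.X t) := h
    rw [h'.fderiv]
    simp [smul_eq_mul]
    ring
  have hn : A.nsq (D.X t) = ‖D.A₀ t‖ ^ 2 := by rw [nsq, A.amp_X ht]
  have hκ : D.κ t ≠ 0 := (D.hκpos t htJ).ne'
  have h1 : ∑ μ, fderiv ℝ A.nsq (D.X t) (E4.basisVector μ) * D.Wc μ (D.X t) =
      (-((opTrace G D.P D.M D.c t).re / D.κ t) * ‖D.A₀ t‖ ^ 2) * D.κ t := by
    rw [Finset.sum_congr rfl fun μ _ ↦ by rw [A.fderiv_nsq_X ht μ, D.Wc_X htJ μ]]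
    simp only [ite_mul, zero_mul, Finset.sum_ite_eq', Finset.mem_univ, if_true, xdot, Fin.cases_zero,
      mul_one]
  have h2 : ∑ μ, A.nsq (D.X t) * fderiv ℝ (D.Wc μ) (D.X t) (E4.basisVector μ) =
      ‖D.A₀ t‖ ^ 2 * (opTrace G D.P D.M D.c t).re := by
    rw [← Finset.mul_sum, D.sum_fderiv_Wc_X htJ, hn]
  unfold w₁
  simp only [hprod, Finset.sum_add_distrib, h1, h2]
  field_simp
  ring

/-- **`w₁`, cut off in time to the core range**, read on `ℝ × E3`. [cite: Sbierski2015, §4 (proof of the theorem)] -/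
def w₁cut (q : ℝ × E3) : ℝ := (A.timeBump : ℝ → ℝ) q.1 * A.w₁ (E4.ofTimeSpace q.1 q.2)

/-- The cut `w₁` is `C^∞`. [folklore] -/
theorem contDiff_w₁cut : ContDiff ℝ ∞ A.w₁cut :=
  (A.timeBump.contDiff.comp contDiff_fst).mul (A.contDiff_w₁.comp contDiff_ofTimeSpace_uncurry)

/-- The cut `w₁` has compact support. [folklore] -/
theorem hasCompactSupport_w₁cut : HasCompactSupport A.w₁cut :=
  (hasCompactSupport_comp_ofTimeSpace A.hasCompactSupport_w₁).mul_left

/-- The cut `w₁` vanishes along the centre (order `0`). [cite: Sbierski2015, §4 (proof of the theorem)] -/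
theorem iteratedFDeriv_w₁cut_eq_zero (t : ℝ) {k : ℕ} (hk : k ≤ 0) :
    iteratedFDeriv ℝ k (fun y ↦ A.w₁cut (t, y)) (A.ce t) = 0 := by
  obtain rfl : k = 0 := Nat.le_zero.1 hk
  ext m
  rw [iteratedFDeriv_zero_apply, zero_apply]
  by_cases hρ : (A.timeBump : ℝ → ℝ) t = 0
  · simp [w₁cut, hρ]
  · have ht := A.mem_Ioo_of_timeBump_ne_zero hρ
    rw [A.ce_eq (A.Ioo_subset_timeHull ht)]
    have h := A.w₁_X ht
    simp only [BeamData.X] at h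
    simp [w₁cut, h]

/-- **Flat bound for `w₁` over `[0, T]`**: `|w₁(x)| ≤ D_w ‖x⃗ − c(x⁰)‖`. [cite: Sbierski2015, §4 (proof of the theorem: first bracket of `div X`)] -/
theorem exists_w₁_bound : ∃ Dw : ℝ, 0 ≤ Dw ∧ ∀ t ∈ Icc (0 : ℝ) T, ∀ y : E3,
    |A.w₁ (E4.ofTimeSpace t y)| ≤ Dw * ‖y - D.c t‖ := by
  obtain ⟨Dw, hDw, h⟩ := exists_norm_le_norm_sub_pow A.ce A.contDiff_ce A.w₁cut A.contDiff_w₁cut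
    A.hasCompactSupport_w₁cut 0 fun t k hk ↦ A.iteratedFDeriv_w₁cut_eq_zero t hk
  refine ⟨Dw, hDw, fun t ht y ↦ ?_⟩
  have := h t y
  rw [A.ce_eq (A.Icc_subset_timeHull ht), zero_add, pow_one, Real.norm_eq_abs] at this
  simpa [w₁cut, A.timeBump_eq_one ht] using this

/-- **Pointwise bound for the divergence of the current over `[0, T]`**:
`|∑ ∂_μ J^μ (t, y)| ≤ e^{-2λc₀‖y−c(t)‖²} (λ² D_w ‖y−c(t)‖ + λ³ C_a D₁ ‖y−c(t)‖³)`.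
[cite: Sbierski2015, §4 (proof of the theorem: `∫ div X = O(1)`)] -/
theorem exists_divJ_bound : ∃ Dw Ce c₀ : ℝ, 0 ≤ Dw ∧ 0 ≤ Ce ∧ 0 < c₀ ∧
    ∀ lam : ℝ, 0 ≤ lam → ∀ t ∈ Icc (0 : ℝ) T, ∀ y : E3,
      |∑ μ, fderiv ℝ (A.Jcur lam μ) (E4.ofTimeSpace t y) (E4.basisVector μ)| ≤
        Real.exp (-2 * (lam * c₀) * ‖y - D.c t‖ ^ 2) *
          (lam ^ 2 * Dw * ‖y - D.c t‖ + lam ^ 3 * Ce * ‖y - D.c t‖ ^ 3) := by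
  obtain ⟨Dw, hDw, hw⟩ := A.exists_w₁_bound
  obtain ⟨Ca, hCa0, hCa⟩ := A.exists_amp_bound
  obtain ⟨D₁, hD₁0, hD₁⟩ := A.exists_eik_bound
  obtain ⟨c₀, hc₀, hIm⟩ := A.exists_pos_le_im_φ
  refine ⟨Dw, Ca * D₁, c₀, hDw, by positivity, hc₀, fun lam hlam t ht y ↦ ?_⟩
  set x := E4.ofTimeSpace t y with hx
  have htH : t ∈ A.timeHull := A.Icc_subset_timeHull ht
  rw [A.sum_fderiv_Jcur lam x]
  by_cases hxs : x ∈ tsupport A.amp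
  · have hxJ : x 0 ∈ J := A.tsupp_slab hxs
    -- the weight
    have hgw : D.gw lam x ≤ Real.exp (-2 * (lam * c₀) * ‖y - D.c t‖ ^ 2) := by
      have him := hIm x (by simpa [hx] using htH)
      simp only [hx, E4.spatial_ofTimeSpace, E4.ofTimeSpace_apply_zero] at him
      unfold BeamData.gw
      apply Real.exp_le_exp.2
      nlinarith
    -- the second bracket
    have h2 : |∑ μ, A.Qc μ x * (dC D.φ x μ).im| ≤ 2⁻¹ * (Ca * D₁ * ‖y - D.c t‖ ^ 3) := by
      rw [A.sum_Qc_mul_im x]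
      have hs : symbolC G x (dC D.φ x) (dC D.φ x) = defect G D.P D.M D.c x := by
        rw [BeamData.φ]; exact symbolC_phase G D.P D.M D.c D.hJ D.hP D.hM D.hc hxJ
      rw [hs]
      have hn0 : 0 ≤ A.nsq x := A.nsq_nonneg x
      have habs : |2⁻¹ * A.nsq x * (defect G D.P D.M D.c x).im| = 2⁻¹ * (A.nsq x * |(defect G D.P D.M D.c x).im|) := by
        rw [abs_mul, abs_mul, abs_of_pos (by norm_num : (0 : ℝ) < 2⁻¹), abs_of_nonneg hn0]; ring
      rw [habs]
      refine mul_le_mul_of_nonneg_left ?_ (by norm_num)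
      calc A.nsq x * |(defect G D.P D.M D.c x).im| ≤ ‖A.amp x‖ ^ 2 * ‖defect G D.P D.M D.c x‖ :=
            mul_le_mul_of_nonneg_left (Complex.abs_im_le_norm _) (A.nsq_nonneg x)
        _ = ‖A.amp x‖ * ‖A.amp x * defect G D.P D.M D.c x‖ := by rw [norm_mul]; ring
        _ ≤ Ca * (D₁ * ‖y - D.c t‖ ^ 3) := mul_le_mul (hCa x) (hD₁ t htH y) (norm_nonneg _) hCa0
        _ = Ca * D₁ * ‖y - D.c t‖ ^ 3 := by ring
    have h1 := hw t ht y
    rw [abs_mul, abs_mul, abs_of_nonneg (by positivity : (0 : ℝ) ≤ lam ^ 2), abs_of_pos (D.gw_pos lam x)]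
    have hbr : |A.w₁ x - 2 * lam * ∑ μ, A.Qc μ x * (dC D.φ x μ).im| ≤
        Dw * ‖y - D.c t‖ + lam * (Ca * D₁ * ‖y - D.c t‖ ^ 3) := by
      refine (abs_sub _ _).trans ?_
      rw [abs_mul, abs_mul, abs_of_pos (by norm_num : (0 : ℝ) < 2), abs_of_nonneg hlam]
      nlinarith [h1, h2, abs_nonneg (∑ μ, A.Qc μ x * (dC D.φ x μ).im)]
    calc lam ^ 2 * D.gw lam x * |A.w₁ x - 2 * lam * ∑ μ, A.Qc μ x * (dC D.φ x μ).im|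
        ≤ lam ^ 2 * Real.exp (-2 * (lam * c₀) * ‖y - D.c t‖ ^ 2) *
            (Dw * ‖y - D.c t‖ + lam * (Ca * D₁ * ‖y - D.c t‖ ^ 3)) := by
          have := mul_le_mul hgw hbr (abs_nonneg _) (Real.exp_nonneg _)
          calc lam ^ 2 * D.gw lam x * |A.w₁ x - 2 * lam * ∑ μ, A.Qc μ x * (dC D.φ x μ).im|
              = lam ^ 2 * (D.gw lam x * |A.w₁ x - 2 * lam * ∑ μ, A.Qc μ x * (dC D.φ x μ).im|) := by ring
            _ ≤ lam ^ 2 * (Real.exp (-2 * (lam * c₀) * ‖y - D.c t‖ ^ 2) *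
                (Dw * ‖y - D.c t‖ + lam * (Ca * D₁ * ‖y - D.c t‖ ^ 3))) :=
                mul_le_mul_of_nonneg_left this (by positivity)
            _ = _ := by ring
      _ = _ := by ring
  · have h0 : A.w₁ x = 0 := A.w₁_eq_zero hxs
    simp only [h0, A.Qc_eq_zero _ hxs, zero_mul, Finset.sum_const_zero, mul_zero, sub_zero, abs_zero]
    positivity

/-- The current vanishes outside the cylinder over the ball containing the beam. [folklore] -/
theorem Jcur_eq_zero_of_lt (lam : ℝ) (μ : Fin 4) {ρ : ℝ} (hρ : ∀ x ∈ tsupport A.amp, ‖E4.spatial x‖ ≤ ρ)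
    (t : ℝ) {y : E3} (hy : ρ < ‖y‖) : A.Jcur lam μ (E4.ofTimeSpace t y) = 0 := by
  refine A.Jcur_eq_zero lam μ fun h ↦ ?_
  have := hρ _ h
  rw [E4.spatial_ofTimeSpace] at this
  linarith

/-- **The flux difference is the integral of the divergence** (the divergence theorem on the slab
for the compactly supported smooth current `J`):
`λ² (∫ fdens(τ,·) − ∫ fdens(0,·)) = ∫_{(0,τ]} ∫ ∑_μ ∂_μJ^μ`. [cite: Sbierski2015, §4 (proof of the theorem, (appcons))] -/
theorem flux_sub_flux_eq (lam : ℝ) {τ : ℝ} (hτ : 0 ≤ τ) :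
    lam ^ 2 * (∫ y, A.fdens lam (E4.ofTimeSpace τ y)) - lam ^ 2 * (∫ y, A.fdens lam (E4.ofTimeSpace 0 y)) =
      ∫ t in Ioc 0 τ, ∫ y, ∑ μ, fderiv ℝ (A.Jcur lam μ) (E4.ofTimeSpace t y) (E4.basisVector μ) := by
  obtain ⟨ρ, hρ⟩ := A.exists_radius
  have h := E4.integral_sub_eq_integral_divergence (J := fun μ ↦ A.Jcur lam μ)
    (fun μ ↦ (A.contDiff_Jcur lam μ).of_le (by exact_mod_cast le_top)) hτ
    (ρ := ρ) fun μ t _ y hy ↦ A.Jcur_eq_zero_of_lt lam μ hρ t hy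
  simp only [A.Jcur_zero] at h
  rw [MeasureTheory.integral_const_mul, MeasureTheory.integral_const_mul] at h
  exact h

/-- **Approximate conservation of the flux** (Sbierski's (appcons): "`|∫_{Σ_τ} X·n − ∫_{Σ₀} X·n| =
|∫_{R_{[0,T]}} div X| = O(1)`"): there is `K_f ≥ 0` with
`|λ² ∫ fdens(τ,·) − λ² ∫ fdens(0,·)| ≤ K_f` for all `λ ≥ 1`, `0 ≤ τ ≤ T`.
[cite: Sbierski2015, §4 (proof of the theorem, (appcons))] -/
theorem exists_flux_diff_bound : ∃ Kf : ℝ, 0 ≤ Kf ∧ ∀ lam : ℝ, 1 ≤ lam → ∀ τ ∈ Icc (0 : ℝ) T,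
    |lam ^ 2 * (∫ y, A.fdens lam (E4.ofTimeSpace τ y)) - lam ^ 2 * (∫ y, A.fdens lam (E4.ofTimeSpace 0 y))| ≤
      Kf := by
  obtain ⟨Dw, Ce, c₀, hDw, hCe, hc₀, hdiv⟩ := A.exists_divJ_bound
  set I1 : ℝ := ∫ z : E3, ‖z‖ ^ 1 * Real.exp (-2 * ‖z‖ ^ 2) with hI1
  set I3 : ℝ := ∫ z : E3, ‖z‖ ^ 3 * Real.exp (-2 * ‖z‖ ^ 2) with hI3
  have hI1n : 0 ≤ I1 := integral_norm_pow_mul_exp_neg_two_mul_sq_nonneg 1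
  have hI3n : 0 ≤ I3 := integral_norm_pow_mul_exp_neg_two_mul_sq_nonneg 3
  have hsc : 0 < (√c₀)⁻¹ := inv_pos.2 (Real.sqrt_pos.2 hc₀)
  -- the leaf bound `B`, uniform in `λ ≥ 1` and `t ∈ [0, T]`
  set B : ℝ := Dw * ((√c₀)⁻¹ ^ 4 * I1) + Ce * ((√c₀)⁻¹ ^ 6 * I3) with hB
  have hB0 : 0 ≤ B := by positivity
  refine ⟨B * T, mul_nonneg hB0 A.hT0, fun lam hlam τ hτ ↦ ?_⟩
  have hlam0 : 0 < lam := one_pos.trans_le hlam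
  have hsl : √lam * √lam = lam := Real.mul_self_sqrt hlam0.le
  have hleaf : ∀ t ∈ Icc (0 : ℝ) T,
      |∫ y, ∑ μ, fderiv ℝ (A.Jcur lam μ) (E4.ofTimeSpace t y) (E4.basisVector μ)| ≤ B := by
    intro t ht
    have hpt : ∀ y, |∑ μ, fderiv ℝ (A.Jcur lam μ) (E4.ofTimeSpace t y) (E4.basisVector μ)| ≤
        Real.exp (-2 * (lam * c₀) * ‖y - D.c t‖ ^ 2) *
          (0 + lam ^ 2 * Dw * ‖y - D.c t‖ + 0 * ‖y - D.c t‖ ^ 2 + lam ^ 3 * Ce * ‖y - D.c t‖ ^ 3) := by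
      intro y
      refine (hdiv lam hlam0.le t ht y).trans (le_of_eq ?_)
      ring
    have h := abs_integral_le_of_abs_le_poly3 (D.c t) (mul_pos hlam0 hc₀) hpt
    refine h.trans (le_of_eq ?_)
    rw [Real.sqrt_mul hlam0.le, mul_inv, mul_pow, mul_pow, mul_pow, mul_pow, ← hI1, ← hI3]
    have e4 : lam ^ 2 * (√lam)⁻¹ ^ (1 + 3) = 1 := by
      rw [show (√lam)⁻¹ ^ (1 + 3) = ((√lam)⁻¹ * (√lam)⁻¹) ^ 2 by ring, ← mul_inv, hsl, inv_pow,
        mul_inv_cancel₀ (by positivity)]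
    have e6 : lam ^ 3 * (√lam)⁻¹ ^ (3 + 3) = 1 := by
      rw [show (√lam)⁻¹ ^ (3 + 3) = ((√lam)⁻¹ * (√lam)⁻¹) ^ 3 by ring, ← mul_inv, hsl, inv_pow,
        mul_inv_cancel₀ (by positivity)]
    simp only [zero_mul, zero_add, add_zero]
    calc lam ^ 2 * Dw * ((√lam)⁻¹ ^ (1 + 3) * (√c₀)⁻¹ ^ (1 + 3) * I1) +
          lam ^ 3 * Ce * ((√lam)⁻¹ ^ (3 + 3) * (√c₀)⁻¹ ^ (3 + 3) * I3)
        = (lam ^ 2 * (√lam)⁻¹ ^ (1 + 3)) * (Dw * ((√c₀)⁻¹ ^ 4 * I1)) +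
          (lam ^ 3 * (√lam)⁻¹ ^ (3 + 3)) * (Ce * ((√c₀)⁻¹ ^ 6 * I3)) := by ring
      _ = B := by rw [e4, e6, hB]; ring
  rw [A.flux_sub_flux_eq lam hτ.1]
  have hvol : volume (Ioc (0 : ℝ) τ) < ⊤ := measure_Ioc_lt_top
  have hbound : ∀ t ∈ Ioc (0 : ℝ) τ,
      ‖∫ y, ∑ μ, fderiv ℝ (A.Jcur lam μ) (E4.ofTimeSpace t y) (E4.basisVector μ)‖ ≤ B := fun t ht ↦ by
    rw [Real.norm_eq_abs]
    exact hleaf t ⟨ht.1.le, ht.2.trans hτ.2⟩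
  have h := norm_setIntegral_le_of_norm_le_const hvol hbound
  rw [Real.norm_eq_abs, Real.volume_real_Ioc_of_le hτ.1, sub_zero] at h
  exact h.trans (mul_le_mul_of_nonneg_left hτ.2 hB0)

end BeamAmp

/-! ### The lower bound `λ² ∫ mdens(0, ·) ≥ g₀ √λ` -/

namespace BeamAmp

open Literature.Analysis.Asymptotics.GaussianBeam Metric

variable {G : E4 → Fin 4 → Fin 4 → ℝ} {V : Set E4} {J : Set ℝ} {D : BeamData G V J} {T : ℝ}
  (A : BeamAmp D T)

/-- `0` lies in the core range. [folklore] -/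
theorem zero_mem_Ioo : (0 : ℝ) ∈ Ioo (-A.η) (T + A.η) := ⟨by linarith [A.hη], by linarith [A.hη, A.hT0]⟩

/-- **`Im φ(0, y) ≤ C₁ ‖y − c(0)‖²`** (the imaginary part of the phase is an explicit quadratic
form in the displacement). [cite: Sbierski2015, §3 (3.12)] -/
theorem _root_.Literature.Geometry.Lorentzian.GaussianBeam.BeamData.exists_im_φ_le_sq
    (D : BeamData G V J) : ∃ C₁ : ℝ, 0 < C₁ ∧ ∀ y : E3,
    (D.φ (E4.ofTimeSpace 0 y)).im ≤ C₁ * ‖y - D.c 0‖ ^ 2 := by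
  set S : ℝ := ∑ i : Fin 3, ∑ j : Fin 3, |(D.M 0 i.succ j.succ).im| with hS
  have hS0 : 0 ≤ S := Finset.sum_nonneg fun _ _ ↦ Finset.sum_nonneg fun _ _ ↦ abs_nonneg _
  refine ⟨2⁻¹ * S + 1, by positivity, fun y ↦ ?_⟩
  have hd : ∀ i, disp D.c (E4.ofTimeSpace 0 y) i = (y - D.c 0) i := fun i ↦ by simp [disp]
  have hdi : ∀ i, |disp D.c (E4.ofTimeSpace 0 y) i| ≤ ‖y - D.c 0‖ := fun i ↦ by
    rw [hd i, ← Real.norm_eq_abs]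
    exact PiLp.norm_apply_le (y - D.c 0) i
  rw [BeamData.φ, im_phase]
  simp only [E4.ofTimeSpace_apply_zero]
  have hsum : ∑ i : Fin 3, ∑ j : Fin 3, (D.M 0 i.succ j.succ).im * disp D.c (E4.ofTimeSpace 0 y) i *
      disp D.c (E4.ofTimeSpace 0 y) j ≤ S * ‖y - D.c 0‖ ^ 2 := by
    rw [hS, Finset.sum_mul]
    refine Finset.sum_le_sum fun i _ ↦ ?_
    rw [Finset.sum_mul]
    refine Finset.sum_le_sum fun j _ ↦ ?_
    calc (D.M 0 i.succ j.succ).im * disp D.c (E4.ofTimeSpace 0 y) i * disp D.c (E4.ofTimeSpace 0 y) j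
        ≤ |(D.M 0 i.succ j.succ).im * disp D.c (E4.ofTimeSpace 0 y) i * disp D.c (E4.ofTimeSpace 0 y) j| :=
          le_abs_self _
      _ = |(D.M 0 i.succ j.succ).im| * (|disp D.c (E4.ofTimeSpace 0 y) i| * |disp D.c (E4.ofTimeSpace 0 y) j|) := by
          rw [abs_mul, abs_mul]; ring
      _ ≤ |(D.M 0 i.succ j.succ).im| * (‖y - D.c 0‖ * ‖y - D.c 0‖) :=
          mul_le_mul_of_nonneg_left (mul_le_mul (hdi i) (hdi j) (abs_nonneg _) (norm_nonneg _)) (abs_nonneg _)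
      _ = |(D.M 0 i.succ j.succ).im| * ‖y - D.c 0‖ ^ 2 := by ring
  nlinarith [sq_nonneg ‖y - D.c 0‖]

/-- **A ball on the initial leaf where `a = 1` and `T ≥ κ(0)/2`** (`a = A₀(x⁰)` near `X(0)`,
`A₀(0) = 1`, `T(X(0)) = κ(0) > 0` and continuity). [cite: Sbierski2015, §3 (proof of the second lemma: lower bound for the initial energy)] -/
theorem exists_ball_initial : ∃ r₁ : ℝ, 0 < r₁ ∧ ∀ y ∈ ball (D.c 0) r₁,
    A.amp (E4.ofTimeSpace 0 y) = 1 ∧ D.κ 0 / 2 ≤ D.tCo (E4.ofTimeSpace 0 y) := by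
  have h0J : (0 : ℝ) ∈ J := D.h0
  have hcont : Continuous fun y : E3 ↦ E4.ofTimeSpace 0 y := (E4.contDiff_ofTimeSpace 0 (n := 0)).continuous
  have hX0 : D.X 0 = E4.ofTimeSpace 0 (D.c 0) := rfl
  -- `a = 1` near `c(0)`
  have h1 : ∀ᶠ y in 𝓝 (D.c 0), A.amp (E4.ofTimeSpace 0 y) = 1 := by
    have hev : ∀ᶠ x in 𝓝 (E4.ofTimeSpace 0 (D.c 0)), A.amp x = D.A₀ (x 0) := by
      rw [← hX0]; exact A.core 0 A.zero_mem_Ioo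
    filter_upwards [hcont.continuousAt.eventually hev] with y hy
    rw [hy, E4.ofTimeSpace_apply_zero, D.A₀_zero]
  -- `T ≥ κ(0)/2` near `c(0)`
  have h2 : ∀ᶠ y in 𝓝 (D.c 0), D.κ 0 / 2 ≤ D.tCo (E4.ofTimeSpace 0 y) := by
    have hTc : ContinuousAt D.tCo (E4.ofTimeSpace 0 (D.c 0)) := by
      rw [← hX0]
      exact ((D.contDiffOn_Wc 0).contDiffAt (D.isOpen_inter_slab.mem_nhds (D.X_mem h0J))).continuousAt
    have hc2 : ContinuousAt (fun y : E3 ↦ D.tCo (E4.ofTimeSpace 0 y)) (D.c 0) :=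
      hTc.comp hcont.continuousAt
    have hval : D.tCo (E4.ofTimeSpace 0 (D.c 0)) = D.κ 0 := by rw [← hX0]; exact D.tCo_X h0J
    have hlt : D.κ 0 / 2 < D.tCo (E4.ofTimeSpace 0 (D.c 0)) := by
      rw [hval]; linarith [D.hκpos 0 h0J]
    exact (hc2.eventually (lt_mem_nhds hlt)).mono fun y hy ↦ hy.le
  obtain ⟨r₁, hr₁, h⟩ := Metric.eventually_nhds_iff_ball.1 (h1.and h2)
  exact ⟨r₁, hr₁, h⟩

/-- The main density is non-negative. [folklore] -/
theorem mdens_nonneg (lam : ℝ) (x : E4) : 0 ≤ A.mdens lam x :=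
  mul_nonneg (D.gw_pos lam x).le (mul_nonneg (A.nsq_nonneg x) (sq_nonneg _))

/-- A Gaussian has positive integral over a ball. [folklore] -/
theorem _root_.Literature.Geometry.Lorentzian.GaussianBeam.setIntegral_ball_exp_pos (C : ℝ) {r : ℝ}
    (hr : 0 < r) : 0 < ∫ z in ball (0 : E3) r, Real.exp (-2 * C * ‖z‖ ^ 2) := by
  set m : ℝ := Real.exp (-(2 * |C| * r ^ 2)) with hm
  have hm0 : 0 < m := Real.exp_pos _
  have hcont : Continuous fun z : E3 ↦ Real.exp (-2 * C * ‖z‖ ^ 2) := by fun_prop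
  have hint : IntegrableOn (fun z : E3 ↦ Real.exp (-2 * C * ‖z‖ ^ 2)) (ball 0 r) :=
    (hcont.continuousOn.integrableOn_compact (isCompact_closedBall 0 r)).mono_set ball_subset_closedBall
  have hcst : IntegrableOn (fun _ : E3 ↦ m) (ball (0 : E3) r) :=
    (continuous_const.continuousOn.integrableOn_compact (isCompact_closedBall 0 r)).mono_set
      ball_subset_closedBall
  have hle : ∫ _z in ball (0 : E3) r, m ≤ ∫ z in ball (0 : E3) r, Real.exp (-2 * C * ‖z‖ ^ 2) := by
    refine setIntegral_mono_on hcst hint measurableSet_ball fun z hz ↦ ?_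
    rw [hm]
    apply Real.exp_le_exp.2
    rw [mem_ball_zero_iff] at hz
    have hz2 : ‖z‖ ^ 2 ≤ r ^ 2 := by nlinarith [norm_nonneg z]
    have hC : -2 * C * ‖z‖ ^ 2 ≥ -(2 * |C| * ‖z‖ ^ 2) := by
      have := neg_abs_le C
      have := le_abs_self C
      nlinarith [sq_nonneg ‖z‖]
    nlinarith [abs_nonneg C]
  have hvol : 0 < (volume (ball (0 : E3) r)).toReal :=
    ENNReal.toReal_pos (measure_ball_pos volume (0 : E3) hr).ne' measure_ball_lt_top.ne
  rw [setIntegral_const, smul_eq_mul] at hle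
  exact lt_of_lt_of_le (mul_pos hvol hm0) hle

/-- **The lower bound for the initial main term** ("the term `e^{-2λ Im φ}` leads to a `λ^{-3/2}`
damping — and only to a `λ^{-3/2}` damping": `λ² ∫ mdens(0,·) ≥ g₀ √λ` for `λ ≥ 1`).
[cite: Sbierski2015, §3 (second lemma, proof: `E_0(u_λ) ≥ C λ^{1/2}`)] -/
theorem exists_main_lower_bound : ∃ g₀ : ℝ, 0 < g₀ ∧ ∀ lam : ℝ, 1 ≤ lam →
    g₀ * √lam ≤ lam ^ 2 * ∫ y, A.mdens lam (E4.ofTimeSpace 0 y) := by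
  obtain ⟨C₁, hC₁, hIm⟩ := D.exists_im_φ_le_sq
  obtain ⟨r₁, hr₁, hball⟩ := A.exists_ball_initial
  have hκ0 : 0 < D.κ 0 := D.hκpos 0 D.h0
  set Ib : ℝ := ∫ z in ball (0 : E3) r₁, Real.exp (-2 * C₁ * ‖z‖ ^ 2) with hIb
  have hIb0 : 0 < Ib := setIntegral_ball_exp_pos C₁ hr₁
  refine ⟨(D.κ 0 / 2) ^ 2 * Ib, by positivity, fun lam hlam ↦ ?_⟩
  have hlam0 : 0 < lam := one_pos.trans_le hlam
  have hd : Module.finrank ℝ E3 = 3 := finrank_euclideanSpace_fin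
  -- the pointwise lower bound on the ball
  have hpt : ∀ y ∈ ball (D.c 0) r₁,
      (D.κ 0 / 2) ^ 2 * Real.exp (-2 * lam * C₁ * ‖y - D.c 0‖ ^ 2) ≤ A.mdens lam (E4.ofTimeSpace 0 y) := by
    intro y hy
    obtain ⟨ha, hT⟩ := hball y hy
    have hgw : Real.exp (-2 * lam * C₁ * ‖y - D.c 0‖ ^ 2) ≤ D.gw lam (E4.ofTimeSpace 0 y) := by
      unfold BeamData.gw
      apply Real.exp_le_exp.2
      have := hIm y
      nlinarith
    have hn : A.nsq (E4.ofTimeSpace 0 y) = 1 := by simp [nsq, ha]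
    have hT2 : (D.κ 0 / 2) ^ 2 ≤ D.tCo (E4.ofTimeSpace 0 y) ^ 2 :=
      pow_le_pow_left₀ (by positivity) hT 2
    unfold mdens
    rw [hn, one_mul]
    calc (D.κ 0 / 2) ^ 2 * Real.exp (-2 * lam * C₁ * ‖y - D.c 0‖ ^ 2)
        = Real.exp (-2 * lam * C₁ * ‖y - D.c 0‖ ^ 2) * (D.κ 0 / 2) ^ 2 := mul_comm _ _
      _ ≤ D.gw lam (E4.ofTimeSpace 0 y) * D.tCo (E4.ofTimeSpace 0 y) ^ 2 :=
          mul_le_mul hgw hT2 (by positivity) (D.gw_pos lam _).le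
  -- integrate over the ball
  have hmi : Integrable fun y ↦ A.mdens lam (E4.ofTimeSpace 0 y) :=
    integrable_slice (A.contDiff_mdens lam).continuous (A.hasCompactSupport_mdens lam) 0
  have hexp : Continuous fun y : E3 ↦ (D.κ 0 / 2) ^ 2 * Real.exp (-2 * lam * C₁ * ‖y - D.c 0‖ ^ 2) := by
    fun_prop
  have hballI : ∫ y in ball (D.c 0) r₁, (D.κ 0 / 2) ^ 2 * Real.exp (-2 * lam * C₁ * ‖y - D.c 0‖ ^ 2) ≤
      ∫ y in ball (D.c 0) r₁, A.mdens lam (E4.ofTimeSpace 0 y) :=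
    setIntegral_mono_on ((hexp.continuousOn.integrableOn_compact (isCompact_closedBall _ _)).mono_set
      ball_subset_closedBall) hmi.integrableOn measurableSet_ball hpt
  have hwhole : ∫ y in ball (D.c 0) r₁, A.mdens lam (E4.ofTimeSpace 0 y) ≤ ∫ y, A.mdens lam (E4.ofTimeSpace 0 y) :=
    setIntegral_le_integral hmi (Eventually.of_forall fun y ↦ A.mdens_nonneg lam _)
  have hscale := le_setIntegral_ball_exp_neg_mul_sq C₁ hr₁ hlam (D.c 0) (V := E3)
  rw [hd, ← hIb] at hscale
  rw [integral_const_mul] at hballI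
  -- `λ² (√λ)⁻¹^3 = √λ`
  have hsl : √lam * √lam = lam := Real.mul_self_sqrt hlam0.le
  have hpow : lam ^ 2 * (√lam)⁻¹ ^ 3 = √lam := by
    have hs0 : √lam ≠ 0 := (Real.sqrt_pos.2 hlam0).ne'
    field_simp
    nlinarith [hsl]
  calc (D.κ 0 / 2) ^ 2 * Ib * √lam = lam ^ 2 * ((D.κ 0 / 2) ^ 2 * ((√lam)⁻¹ ^ 3 * Ib)) := by
        rw [show (D.κ 0 / 2) ^ 2 * Ib * √lam = (D.κ 0 / 2) ^ 2 * Ib * (lam ^ 2 * (√lam)⁻¹ ^ 3) by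
          rw [hpow]]
        ring
    _ ≤ lam ^ 2 * ((D.κ 0 / 2) ^ 2 * ∫ y in ball (D.c 0) r₁, Real.exp (-2 * lam * C₁ * ‖y - D.c 0‖ ^ 2)) := by
        gcongr
    _ ≤ lam ^ 2 * ∫ y, A.mdens lam (E4.ofTimeSpace 0 y) := by
        refine mul_le_mul_of_nonneg_left (hballI.trans hwhole) (by positivity)

end BeamAmp

/-! ### Assembly: the energy of the beam against the energy of the geodesic -/

namespace BeamAmp

open Literature.Analysis.Asymptotics.GaussianBeam

variable {G : E4 → Fin 4 → Fin 4 → ℝ} {V : Set E4} {J : Set ℝ} {D : BeamData G V J} {T : ℝ}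
  (A : BeamAmp D T)

/-- Triangle inequality for four terms. [folklore] -/
theorem abs_add_four (a b c d : ℝ) : |a + b + c + d| ≤ |a| + |b| + |c| + |d| :=
  (abs_add_le _ _).trans (add_le_add ((abs_add_le _ _).trans (add_le_add (abs_add_le _ _) le_rfl)) le_rfl)

/-- **Characterisation of the energy of the real Gaussian beam by the energy of the geodesic,
up to the thinness `δ` of the beam and bounded errors** (Sbierski's theorem of §4 for the real
beam, before normalisation). Suppose that on the beam over `0 ≤ x⁰ ≤ T` the function
`T = (G dφ₁)⁰` (`= −Vφ₁`) is `δ`-close to its value `κ(x⁰)` on the geodesic, with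
`2δ ≤ κ ≤ κ_max` there, and that the oscillatory cross terms are bounded by `K_c` (real beams:
`exists_cross_bound`). Then there are `C_b ≥ 0`, `g₀ > 0`, `K' ≥ 0` such that for all `λ ≥ 1`:
`E(0) ≥ g₀ √λ − K'` and, for `0 ≤ τ ≤ T`,
`|E(τ) − (κ(τ)/κ(0)) E(0)| ≤ (2 (1 + κ_max/κ(0)) / κ(0)) · δ · E(0) + C_b`,
the constant in front of `δ E(0)` depending on `κ(0), κ_max` only ("choose `𝒩₁(δ)` so small that
`Nφ₁` is roughly constant, then `λ` large"). [cite: Sbierski2015, §4 (the theorem and its proof); third remark after it] -/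
theorem energy_characterisation {δ κmax Kc : ℝ} (hδ0 : 0 ≤ δ)
    (hδκ : ∀ τ ∈ Icc (0 : ℝ) T, 2 * δ ≤ D.κ τ) (hκmax : ∀ τ ∈ Icc (0 : ℝ) T, D.κ τ ≤ κmax)
    (hδ : ∀ τ ∈ Icc (0 : ℝ) T, ∀ y : E3, E4.ofTimeSpace τ y ∈ tsupport A.amp →
      |D.tCo (E4.ofTimeSpace τ y) - D.κ τ| ≤ δ)
    (hcross : ∀ lam : ℝ, 1 ≤ lam → ∀ τ ∈ Icc (0 : ℝ) T, |∫ y, A.wdensO lam (E4.ofTimeSpace τ y)| ≤ Kc) :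
    ∃ Cb g₀ K' : ℝ, 0 ≤ Cb ∧ 0 < g₀ ∧ 0 ≤ K' ∧ ∀ lam : ℝ, 1 ≤ lam →
      g₀ * √lam - K' ≤ A.energy lam 0 ∧
      ∀ τ ∈ Icc (0 : ℝ) T, |A.energy lam τ - D.κ τ / D.κ 0 * A.energy lam 0| ≤
        (2 * (1 + κmax / D.κ 0) / D.κ 0) * δ * A.energy lam 0 + Cb := by
  obtain ⟨Ks, hKs, hrem⟩ := A.exists_wdensH_sub_main_bound
  obtain ⟨Kf, hKf, hflux⟩ := A.exists_flux_diff_bound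
  obtain ⟨g₁, hg₁, hlow⟩ := A.exists_main_lower_bound
  have h0T : (0 : ℝ) ∈ Icc (0 : ℝ) T := ⟨le_rfl, A.hT0⟩
  have hκ0 : 0 < D.κ 0 := D.hκpos 0 D.h0
  have hKc : 0 ≤ Kc := (abs_nonneg _).trans (hcross 1 le_rfl 0 h0T)
  have hκm : D.κ 0 ≤ κmax := hκmax 0 h0T
  have hκmax0 : 0 ≤ κmax := hκ0.le.trans hκm
  have hδκ0 : 2 * δ ≤ D.κ 0 := hδκ 0 h0T
  set r : ℝ := κmax / D.κ 0 with hr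
  have hr0 : 0 ≤ r := by positivity
  set Cb : ℝ := 2⁻¹ * κmax * Kf + 2⁻¹ * δ * Kf + 2⁻¹ * (1 + r) * (Ks + Kc) + (1 + r) * δ * (Ks + Kc) / D.κ 0
    with hCb
  refine ⟨Cb, 2⁻¹ * g₁, 2⁻¹ * (Ks + Kc), by positivity, by positivity, by positivity, fun lam hlam ↦ ?_⟩
  have hlam0 : 0 < lam := one_pos.trans_le hlam
  have hl2 : 0 ≤ lam ^ 2 := by positivity
  have hs1 : (√lam)⁻¹ ≤ 1 := by
    have : 1 ≤ √lam := by rw [← Real.sqrt_one]; exact Real.sqrt_le_sqrt hlam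
    exact inv_le_one_of_one_le₀ this
  -- the quantities on a leaf
  have hremτ : ∀ τ, |(∫ y, A.wdensH lam (E4.ofTimeSpace τ y)) - lam ^ 2 * ∫ y, A.mdens lam (E4.ofTimeSpace τ y)| ≤ Ks :=
    fun τ ↦ (hrem lam hlam τ).trans (mul_le_of_le_one_right hKs hs1)
  -- initial lower bound
  have hE0 : 2⁻¹ * g₁ * √lam - 2⁻¹ * (Ks + Kc) ≤ A.energy lam 0 := by
    have h1 := hlow lam hlam
    have h2 := abs_le.1 (hremτ 0)
    have h3 := abs_le.1 (hcross lam hlam 0 h0T)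
    rw [A.energy_eq lam 0]
    linarith [h2.1, h3.1]
  refine ⟨hE0, fun τ hτ ↦ ?_⟩
  have hκτ : 0 < D.κ τ := D.hκpos τ (A.Icc_subset hτ)
  have hκτm : D.κ τ ≤ κmax := hκmax τ hτ
  set q : ℝ := D.κ τ / D.κ 0 with hq
  have hq0 : 0 ≤ q := by positivity
  have hqr : q ≤ r := div_le_div_of_nonneg_right hκτm hκ0.le
  have hqκ : q * D.κ 0 = D.κ τ := div_mul_cancel₀ _ hκ0.ne'
  -- abbreviations
  set F0 : ℝ := lam ^ 2 * ∫ y, A.fdens lam (E4.ofTimeSpace 0 y) with hF0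
  set Fτ : ℝ := lam ^ 2 * ∫ y, A.fdens lam (E4.ofTimeSpace τ y) with hFτ
  set Mτ : ℝ := lam ^ 2 * ∫ y, A.mdens lam (E4.ofTimeSpace τ y) with hMτ
  set M0 : ℝ := lam ^ 2 * ∫ y, A.mdens lam (E4.ofTimeSpace 0 y) with hM0
  set Hτ : ℝ := ∫ y, A.wdensH lam (E4.ofTimeSpace τ y) with hHτ
  set H0 : ℝ := ∫ y, A.wdensH lam (E4.ofTimeSpace 0 y) with hH0
  set Oτ : ℝ := ∫ y, A.wdensO lam (E4.ofTimeSpace τ y) with hOτ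
  set O0 : ℝ := ∫ y, A.wdensO lam (E4.ofTimeSpace 0 y) with hO0
  -- the error bounds
  obtain ⟨hmfτ, hFτn'⟩ := A.abs_integral_mdens_sub_le lam (τ := τ) (by linarith [hδκ τ hτ]) (hδ τ hτ)
  obtain ⟨hmf0, hF0n'⟩ := A.abs_integral_mdens_sub_le lam (τ := 0) (by linarith [hδκ0]) (hδ 0 h0T)
  have hF0n : 0 ≤ F0 := by rw [hF0]; positivity
  have hFτn : 0 ≤ Fτ := by rw [hFτ]; positivity
  have hAτ : |Mτ - D.κ τ * Fτ| ≤ δ * Fτ := by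
    rw [hMτ, hFτ, show lam ^ 2 * (∫ y, A.mdens lam (E4.ofTimeSpace τ y)) -
        D.κ τ * (lam ^ 2 * ∫ y, A.fdens lam (E4.ofTimeSpace τ y)) =
        lam ^ 2 * ((∫ y, A.mdens lam (E4.ofTimeSpace τ y)) - D.κ τ * ∫ y, A.fdens lam (E4.ofTimeSpace τ y)) by ring,
      abs_mul, abs_of_nonneg hl2, show δ * (lam ^ 2 * ∫ y, A.fdens lam (E4.ofTimeSpace τ y)) =
        lam ^ 2 * (δ * ∫ y, A.fdens lam (E4.ofTimeSpace τ y)) by ring]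
    exact mul_le_mul_of_nonneg_left hmfτ hl2
  have hA0 : |M0 - D.κ 0 * F0| ≤ δ * F0 := by
    rw [hM0, hF0, show lam ^ 2 * (∫ y, A.mdens lam (E4.ofTimeSpace 0 y)) -
        D.κ 0 * (lam ^ 2 * ∫ y, A.fdens lam (E4.ofTimeSpace 0 y)) =
        lam ^ 2 * ((∫ y, A.mdens lam (E4.ofTimeSpace 0 y)) - D.κ 0 * ∫ y, A.fdens lam (E4.ofTimeSpace 0 y)) by ring,
      abs_mul, abs_of_nonneg hl2, show δ * (lam ^ 2 * ∫ y, A.fdens lam (E4.ofTimeSpace 0 y)) =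
        lam ^ 2 * (δ * ∫ y, A.fdens lam (E4.ofTimeSpace 0 y)) by ring]
    exact mul_le_mul_of_nonneg_left hmf0 hl2
  clear_value q F0 Fτ Mτ M0 Hτ H0 Oτ O0
  have hHτb : |Hτ - Mτ| ≤ Ks := by rw [hHτ, hMτ]; exact hremτ τ
  have hH0b : |H0 - M0| ≤ Ks := by rw [hH0, hM0]; exact hremτ 0
  have hOτb : |Oτ| ≤ Kc := by rw [hOτ]; exact hcross lam hlam τ hτ
  have hO0b : |O0| ≤ Kc := by rw [hO0]; exact hcross lam hlam 0 h0T
  have hfl : |Fτ - F0| ≤ Kf := by rw [hFτ, hF0]; exact hflux lam hlam τ hτ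
  -- the identity for the difference
  have hEτ : A.energy lam τ = 2⁻¹ * Hτ + 2⁻¹ * Oτ := by rw [hHτ, hOτ]; exact A.energy_eq lam τ
  have hE0' : A.energy lam 0 = 2⁻¹ * H0 + 2⁻¹ * O0 := by rw [hH0, hO0]; exact A.energy_eq lam 0
  have hid : A.energy lam τ - q * A.energy lam 0 =
      2⁻¹ * D.κ τ * (Fτ - F0) + 2⁻¹ * ((Mτ - D.κ τ * Fτ) - q * (M0 - D.κ 0 * F0)) +
        2⁻¹ * ((Hτ - Mτ) - q * (H0 - M0)) + 2⁻¹ * (Oτ - q * O0) := by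
    rw [hEτ, hE0']
    have : q * (D.κ 0 * F0) = D.κ τ * F0 := by rw [← mul_assoc, hqκ]
    linear_combination (-2⁻¹ : ℝ) * this
  -- bound each term
  have b1 : |2⁻¹ * D.κ τ * (Fτ - F0)| ≤ 2⁻¹ * κmax * Kf := by
    rw [abs_mul, abs_mul, abs_of_pos (by norm_num : (0 : ℝ) < 2⁻¹), abs_of_pos hκτ]
    exact mul_le_mul (mul_le_mul_of_nonneg_left hκτm (by norm_num)) hfl (abs_nonneg _) (by positivity)
  have b2 : |2⁻¹ * ((Mτ - D.κ τ * Fτ) - q * (M0 - D.κ 0 * F0))| ≤ 2⁻¹ * (δ * Fτ + q * (δ * F0)) := by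
    rw [abs_mul, abs_of_pos (by norm_num : (0 : ℝ) < 2⁻¹)]
    refine mul_le_mul_of_nonneg_left ((abs_sub _ _).trans (add_le_add hAτ ?_)) (by norm_num)
    rw [abs_mul, abs_of_nonneg hq0]
    exact mul_le_mul_of_nonneg_left hA0 hq0
  have b3 : |2⁻¹ * ((Hτ - Mτ) - q * (H0 - M0))| ≤ 2⁻¹ * (Ks + q * Ks) := by
    rw [abs_mul, abs_of_pos (by norm_num : (0 : ℝ) < 2⁻¹)]
    refine mul_le_mul_of_nonneg_left ((abs_sub _ _).trans (add_le_add hHτb ?_)) (by norm_num)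
    rw [abs_mul, abs_of_nonneg hq0]
    exact mul_le_mul_of_nonneg_left hH0b hq0
  have b4 : |2⁻¹ * (Oτ - q * O0)| ≤ 2⁻¹ * (Kc + q * Kc) := by
    rw [abs_mul, abs_of_pos (by norm_num : (0 : ℝ) < 2⁻¹)]
    refine mul_le_mul_of_nonneg_left ((abs_sub _ _).trans (add_le_add hOτb ?_)) (by norm_num)
    rw [abs_mul, abs_of_nonneg hq0]
    exact mul_le_mul_of_nonneg_left hO0b hq0
  -- `F0` against `E(0)`
  have hF0E : F0 ≤ 4 / D.κ 0 * (A.energy lam 0 + 2⁻¹ * (Ks + Kc)) := by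
    rw [div_mul_eq_mul_div, le_div_iff₀ hκ0, hE0']
    have hA0' := abs_le.1 hA0
    have hH0' := abs_le.1 hH0b
    have hO0' := abs_le.1 hO0b
    have hδF : δ * F0 ≤ 2⁻¹ * (D.κ 0 * F0) := by
      have := mul_le_mul_of_nonneg_right hδκ0 hF0n
      linarith
    have h1 : D.κ 0 * F0 ≤ M0 + δ * F0 := by linarith [hA0'.1]
    have h2 : M0 ≤ H0 + Ks := by linarith [hH0'.1]
    have h3 : -Kc ≤ O0 := by linarith [hO0'.1]
    linarith
  have hFτE : Fτ ≤ F0 + Kf := by linarith [(abs_le.1 hfl).2]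
  -- assemble
  rw [hid]
  refine (abs_add_four _ _ _ _).trans ?_
  have hsum : 2⁻¹ * κmax * Kf + 2⁻¹ * (δ * Fτ + q * (δ * F0)) + 2⁻¹ * (Ks + q * Ks) + 2⁻¹ * (Kc + q * Kc) ≤
      (2 * (1 + κmax / D.κ 0) / D.κ 0) * δ * A.energy lam 0 + Cb := by
    have p2 : δ * Fτ ≤ δ * F0 + δ * Kf := by
      have := mul_le_mul_of_nonneg_left hFτE hδ0; rwa [mul_add] at this
    have p3 : q * (δ * F0) ≤ r * (δ * F0) := mul_le_mul_of_nonneg_right hqr (by positivity)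
    have p4 : q * Ks ≤ r * Ks := mul_le_mul_of_nonneg_right hqr hKs
    have p5 : q * Kc ≤ r * Kc := mul_le_mul_of_nonneg_right hqr hKc
    have p6 : (1 + r) * δ * F0 ≤ (1 + r) * δ * (4 / D.κ 0 * (A.energy lam 0 + 2⁻¹ * (Ks + Kc))) :=
      mul_le_mul_of_nonneg_left hF0E (by positivity)
    -- rewrite both sides as linear expressions in the atoms
    have hL : 2⁻¹ * κmax * Kf + 2⁻¹ * (δ * Fτ + q * (δ * F0)) + 2⁻¹ * (Ks + q * Ks) + 2⁻¹ * (Kc + q * Kc) =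
        2⁻¹ * (κmax * Kf) + 2⁻¹ * (δ * Fτ) + 2⁻¹ * (q * (δ * F0)) + 2⁻¹ * Ks + 2⁻¹ * (q * Ks) +
          2⁻¹ * Kc + 2⁻¹ * (q * Kc) := by ring
    have hR : (2 * (1 + κmax / D.κ 0) / D.κ 0) * δ * A.energy lam 0 + Cb =
        2⁻¹ * ((1 + r) * δ * (4 / D.κ 0 * (A.energy lam 0 + 2⁻¹ * (Ks + Kc)))) +
          2⁻¹ * (κmax * Kf) + 2⁻¹ * (δ * Kf) + 2⁻¹ * Ks + 2⁻¹ * (r * Ks) + 2⁻¹ * Kc + 2⁻¹ * (r * Kc) := by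
      rw [hCb, hr]; field_simp; ring
    have hmid : (1 + r) * δ * F0 = δ * F0 + r * (δ * F0) := by ring
    rw [hL, hR]
    linarith [p2, p3, p4, p5, p6, hmid]
  exact (add_le_add (add_le_add (add_le_add b1 b2) b3) b4).trans hsum

end BeamAmp

end GaussianBeam

end Literature.Geometry.Lorentzian
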